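import Literature.NumberTheory.LFunctions.HuxleyZeroDetection
import Literature.NumberTheory.Sieve.DivisorBound
import Mathlib.Analysis.MellinInversion
import Mathlib.NumberTheory.LSeries.Convolution
import HarnessLib

/-!
# The reflection principle for `ζ(s)²` on the critical line (Ivić §4.4, as used for (8.26))

Trunk T-ANT (`Literature/NumberTheory/LFunctions`), family RH. Seventh file (part A) of the
decomposition of the named fact `Literature.NumberTheory.LFunctions.zeroDensity_huxley` (`ZeroCounting.lean`). It PROVES the
analytic identity behind the discrete fourth power moment of `ζ(1/2+it)` (Ivić, *The Riemann
Zeta-Function* (1985), Ch. 8, (8.26), "From the reflection principle estimate (4.66) with `k = 2` …";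
the mean-square bookkeeping and the moment bound itself are in `ZetaFourthMomentDiscrete.lean`):
for `re s = 1/2`, `X > 0`, `N ∈ ℕ`,

  `ζ(s)² = E(s) + F(1−s)² A_N(1−s) − (2π)⁻¹ G − (2π)⁻¹ H`     (`Literature.NumberTheory.LFunctions.ZetaM4.zeta_sq_decomposition`)

where `E(s) = ∑ d(n) ψ(n/X) n^{-s}` is a combination of three exponentially smoothed divisor sums
(`Esum`, weights `e^{-x}`, `x e^{-x}`, `(x² − x) e^{-x}`), `F(z) = 2(2π)^{-z} Γ(z) cos(πz/2)` is the
factor of the functional equation `ζ(z) = F(1−z) ζ(1−z)` (`feFactor`, Mathlib `riemannZeta_one_sub`),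
`A_N(u) = ∑_{n ≤ N} d(n) n^{-u}` (`dirPoly`), and `G`, `H` (`Gint`, `Hint`) are absolutely convergent
integrals over the lines `re w = 1/4` resp. `re w = −3/4` of the reflected kernel
`K(w)/w = (s+w−1)² F(1−s−w)² Γ(w+1) X^w / ((s−1)² w)` (`rK`) against `A_N(1−s−w)` resp. the tail
`∑_{n > N} d(n) n^{-(1−s−w)}` (`tailCoeff`).

## The argument

* **§1** bounds for `Γ` on the lines `re = 1/4, 5/4`, sharp in the imaginary part
  (`|Γ(5/4+iy)|² ≪ e^{-π|y|} |y|^{3/2}`, `|Γ(1/4+iy)|² ≪ e^{-π|y|} |y|^{-1/2}`, from the log-convexity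
  tools of the tree's `GammaVerticalBounds` as packaged in `HuxleyZeroDetection.lean`), hence
  `|F(5/4+iy)| ≪ (1+|y|)^{3/4}`, `|F(1/4+iy)| ≪ (1+|y|)^{-1/4}`, `|F(1/2+iy)| ≤ 8π²`, and a crude
  bound on the strip `1/4 ≤ re ≤ 5/4`.
* **§2** `d = 1 ⋆ 1` with `L(d, s) = ζ(s)²` (`dCoeff`, `LSeries_dCoeff`, Mathlib
  `LSeries.convolution`); Mellin's inversion `x^k e^{-x} = (2πi)⁻¹ ∫_{(2)} Γ(w+k) x^{-w} dw`, `k ≤ 2`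
  (`mellinInv_Gamma_add_two`, Mathlib `mellinInv_mellin_eq`), and termwise integration of the
  absolutely convergent Dirichlet series (`integral_GammaK_cpow_LSeries_two`).
* **§3** majorants `(1+|y|)^m e^{-π|y|/2}` and their integrals; `Γ` and `ζ₁ = (s−1)ζ` in strips.
* **§4** the integrand `F_s(w) = ζ₁(s+w)² Γ(w+1) X^w/(s−1)²` (`m4Num`): `F_s(w)/w` equals
  `ζ²(s+w) Γ(w) X^w (1 + w/(s−1))²`, is holomorphic in `re w > −1` except for the simple pole `w = 0`
  with residue `ζ(s)²` (the factor `(s+w−1)²` removes the double pole of `ζ²(s+w)` at `w = 1−s`);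
  Mellin on `re w = 2` (`integral_m4Num_two`) and the shift to `re w = −3/4`
  (`Literature.NumberTheory.LFunctions.HuxleyZeroDetection.integral_vertical_sub_eq_of_pole`): `m4_identity₁`.
* **§5** the functional equation on `re w = −3/4` (`m4Num_div_eq_rK`), the split
  `L(d, u) = A_N(u) + ∑_{n>N}` for `re u = 5/4`, the shift of the finite part back to `re w = 1/4`
  across `w = 0` with residue `F(1−s)² A_N(1−s)` (`Gfun_shift`), and the decomposition.

## Main statements (all proved)

* `Literature.NumberTheory.LFunctions.ZetaM4.feFactor`, `Literature.NumberTheory.LFunctions.ZetaM4.riemannZeta_eq_feFactor_mul`, the bounds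
  `exists_norm_feFactor_five_quarters_le`, `exists_norm_feFactor_quarter_le`, `norm_feFactor_half_le`.
* `Literature.NumberTheory.LFunctions.ZetaM4.LSeries_dCoeff`, `Literature.NumberTheory.LFunctions.ZetaM4.integral_GammaK_cpow_LSeries_two`.
* `Literature.NumberTheory.LFunctions.ZetaM4.m4_identity₁`, `Literature.NumberTheory.LFunctions.ZetaM4.zeta_sq_decomposition`.

## References

* A. Ivić, *The Riemann Zeta-Function*, Wiley 1985, §4.4 (the reflection principle, (4.60)–(4.67)),
  Ch. 8, proof of (8.26).
* E. C. Titchmarsh, *The Theory of the Riemann Zeta-Function*, 2nd ed. 1986, §2.1 (the functional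
  equation (2.1.1)), §4.14.
* M. N. Huxley, *The Distribution of Prime Numbers*, Oxford 1972, Ch. 22 (the fourth-power moment via
  an approximate functional equation for `L²`).
-/

noncomputable section

open Real Set Filter Topology Complex MeasureTheory Finset
open scoped ComplexConjugate

namespace Literature.NumberTheory.LFunctions

namespace ZetaM4

open HuxleyZeroDetection

/-! ## §1. Sharp bounds for `Γ` on the lines `re = 1/4, 5/4` and the factor of the functional equation -/

/-- `‖Γ(x − iy)‖ = ‖Γ(x + iy)‖`. [folklore] -/
theorem norm_Gamma_ofReal_sub (x y : ℝ) :
    ‖Complex.Gamma (x + (-y : ℝ) * I)‖ = ‖Complex.Gamma (x + y * I)‖ := by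
  have h : (x : ℂ) + ((-y : ℝ) : ℂ) * I = conj ((x : ℂ) + y * I) := by
    apply Complex.ext <;> simp
  rw [h, Complex.Gamma_conj, Complex.norm_conj]

/-- `sinh u ≥ e^u/4` for `u ≥ 1`. [folklore] -/
theorem exp_le_four_mul_sinh {u : ℝ} (hu : 1 ≤ u) : Real.exp u ≤ 4 * Real.sinh u := by
  rw [Real.sinh_eq]
  have h1 : Real.exp (-u) ≤ Real.exp u / 2 := by
    have h2 : Real.exp (-u) * Real.exp (-u) ≤ 1 / 2 * 1 := by
      rw [← Real.exp_add]
      have : Real.exp (-u + -u) ≤ Real.exp (-2) := Real.exp_le_exp.2 (by linarith)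
      have h3 : Real.exp (-2) ≤ 1 / 2 := by
        rw [Real.exp_neg, inv_le_comm₀ (Real.exp_pos _) (by norm_num)]
        have := Real.add_one_le_exp (2 : ℝ); linarith
      linarith
    have h4 : Real.exp (-u) * Real.exp u = 1 := by rw [← Real.exp_add]; simp
    nlinarith [Real.exp_pos u, Real.exp_pos (-u)]
  linarith

/-- `log(sinh(πy)/(πy)) ≥ πy − log(4πy)` for `y ≥ 1`. [folklore] -/
theorem log_sinh_div_ge {y : ℝ} (hy : 1 ≤ y) :
    π * y - Real.log (4 * π * y) ≤ Real.log (Real.sinh (π * y) / (π * y)) := by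
  have hπ := Real.pi_gt_three
  have hπy : 1 ≤ π * y := by nlinarith
  have hs : 0 < Real.sinh (π * y) := Real.sinh_pos_iff.2 (by positivity)
  rw [Real.log_div hs.ne' (by positivity)]
  have h1 := exp_le_four_mul_sinh hπy
  have h2 : Real.log (Real.exp (π * y)) ≤ Real.log (4 * Real.sinh (π * y)) :=
    Real.log_le_log (Real.exp_pos _) h1
  rw [Real.log_exp, Real.log_mul (by norm_num) hs.ne'] at h2
  have h3 : Real.log (4 * π * y) = Real.log 4 + Real.log (π * y) := by
    rw [mul_assoc, Real.log_mul (by norm_num) (by positivity)]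
  linarith

/-- `log cosh(πy) ≤ πy` for `y ≥ 0`. [folklore] -/
theorem log_cosh_le {y : ℝ} (hy : 0 ≤ y) : Real.log (Real.cosh (π * y)) ≤ π * y := by
  have hc : 0 < Real.cosh (π * y) := Real.cosh_pos _
  have : Real.cosh (π * y) ≤ Real.exp (π * y) := by
    rw [Real.cosh_eq]
    have : Real.exp (-(π * y)) ≤ Real.exp (π * y) :=
      Real.exp_le_exp.2 (by nlinarith [Real.pi_pos])
    linarith
  calc Real.log (Real.cosh (π * y)) ≤ Real.log (Real.exp (π * y)) := Real.log_le_log hc this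
    _ = π * y := Real.log_exp _

/-- **Sharp bound for `Γ` on `re = 5/4`** (log-convexity of `x ↦ Γ(x)²/|Γ(x+iy)|²` through the
nodes `1/2 < 1 < 5/4` and the exact values at `1/2`, `1`): for `y ≥ 1`,
`‖Γ(5/4 + iy)‖² ≤ Γ(5/4)² (4π)^{3/2} y^{3/2} e^{-πy}`. [folklore] -/
theorem norm_sq_Gamma_five_quarters_le_of_one_le {y : ℝ} (hy : 1 ≤ y) :
    ‖Complex.Gamma ((5 / 4 : ℝ) + y * I)‖ ^ 2 ≤
      Real.Gamma (5 / 4) ^ 2 * (4 * π) ^ (3 / 2 : ℝ) * y ^ (3 / 2 : ℝ) * Real.exp (-(π * y)) := by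
  have hπ := Real.pi_gt_three
  have hy0 : 0 < y := by linarith
  have hyne : y ≠ 0 := hy0.ne'
  -- the three ratios
  set Qh := Real.Gamma (1 / 2) ^ 2 / ‖Complex.Gamma (((1 / 2 : ℝ) : ℂ) + y * I)‖ ^ 2 with hQh
  set Q1 := Real.Gamma 1 ^ 2 / ‖Complex.Gamma (((1 : ℝ) : ℂ) + y * I)‖ ^ 2 with hQ1
  set Q := Real.Gamma (5 / 4) ^ 2 / ‖Complex.Gamma (((5 / 4 : ℝ) : ℂ) + y * I)‖ ^ 2 with hQ
  have hconv := Literature.Analysis.SpecialFunctions.GammaVert.slope_log_gammaRatio_mono y (a := 1 / 2) (b := 1) (c := 5 / 4)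
    (by norm_num) (by norm_num) (by norm_num)
  rw [← hQh, ← hQ1, ← hQ] at hconv
  -- exact values
  have hQ1v : Q1 = Real.sinh (π * y) / (π * y) := Literature.Analysis.SpecialFunctions.GammaVert.gammaRatio_one hyne
  have hQhv : Qh = Real.cosh (π * y) := by
    rw [hQh, show (((1 / 2 : ℝ) : ℂ)) = 1 / 2 by push_cast; ring, Literature.Analysis.SpecialFunctions.GammaVert.norm_sq_Gamma_half,
      Literature.Analysis.SpecialFunctions.GammaVert.Real_Gamma_half_sq]
    have hc : 0 < Real.cosh (π * y) := Real.cosh_pos _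
    field_simp
  have hQpos : 0 < Q := Literature.Analysis.SpecialFunctions.GammaVert.gammaRatio_pos (by norm_num) y
  have hΓpos : 0 < ‖Complex.Gamma (((5 / 4 : ℝ) : ℂ) + y * I)‖ :=
    norm_pos_iff.2 (Literature.Analysis.SpecialFunctions.GammaVert.Gamma_ne_zero_of_pos (by norm_num) y)
  -- log Q ≥ (3/2) log Q1 - (1/2) log Qh
  have hlogQ : 3 / 2 * Real.log Q1 - 1 / 2 * Real.log Qh ≤ Real.log Q := by
    rw [div_le_div_iff₀ (by norm_num) (by norm_num)] at hconv
    linarith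
  have hlogQ1 : π * y - Real.log (4 * π * y) ≤ Real.log Q1 := hQ1v ▸ log_sinh_div_ge hy
  have hlogQh : Real.log Qh ≤ π * y := hQhv ▸ log_cosh_le hy0.le
  -- log of the claim
  have hlog4πy : Real.log (4 * π * y) = Real.log (4 * π) + Real.log y :=
    Real.log_mul (by positivity) hyne
  have hmain : Real.log (‖Complex.Gamma (((5 / 4 : ℝ) : ℂ) + y * I)‖ ^ 2) ≤
      Real.log (Real.Gamma (5 / 4) ^ 2) + 3 / 2 * Real.log (4 * π) + 3 / 2 * Real.log y
        - π * y := by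
    have e : Real.log (‖Complex.Gamma (((5 / 4 : ℝ) : ℂ) + y * I)‖ ^ 2) =
        Real.log (Real.Gamma (5 / 4) ^ 2) - Real.log Q := by
      rw [hQ, Real.log_div (by positivity) (by positivity)]; ring
    rw [e]; linarith
  have hΓ54 : 0 < Real.Gamma (5 / 4) := Real.Gamma_pos_of_pos (by norm_num)
  calc ‖Complex.Gamma (((5 / 4 : ℝ) : ℂ) + y * I)‖ ^ 2
      = Real.exp (Real.log (‖Complex.Gamma (((5 / 4 : ℝ) : ℂ) + y * I)‖ ^ 2)) :=
        (Real.exp_log (by positivity)).symm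
    _ ≤ Real.exp (Real.log (Real.Gamma (5 / 4) ^ 2) + 3 / 2 * Real.log (4 * π) +
          3 / 2 * Real.log y - π * y) := Real.exp_le_exp.2 hmain
    _ = Real.Gamma (5 / 4) ^ 2 * (4 * π) ^ (3 / 2 : ℝ) * y ^ (3 / 2 : ℝ) * Real.exp (-(π * y)) := by
        rw [sub_eq_add_neg, Real.exp_add, Real.exp_add, Real.exp_add, Real.exp_log (by positivity),
          Real.rpow_def_of_pos (by positivity), Real.rpow_def_of_pos hy0]
        ring_nf

/-- **Sharp bound for `Γ` on `re = 1/4`** (the tree's secant bound `log_gammaRatio_ge` through the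
nodes `1 < 3/2`): for `y ≥ 1`, `‖Γ(1/4 + iy)‖² ≤ Γ(1/4)² (4π)^{5/2} 4^{-3/2} y^{-1/2} e^{-πy}`.
[folklore] -/
theorem norm_sq_Gamma_quarter_le_of_one_le {y : ℝ} (hy : 1 ≤ y) :
    ‖Complex.Gamma ((1 / 4 : ℝ) + y * I)‖ ^ 2 ≤
      Real.Gamma (1 / 4) ^ 2 * (4 * π) ^ (5 / 2 : ℝ) * y ^ (-(1 / 2) : ℝ) * Real.exp (-(π * y)) := by
  have hπ := Real.pi_gt_three
  have hy0 : 0 < y := by linarith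
  have hyne : y ≠ 0 := hy0.ne'
  set Q1 := Real.Gamma 1 ^ 2 / ‖Complex.Gamma (((1 : ℝ) : ℂ) + y * I)‖ ^ 2 with hQ1
  set Q3 := Real.Gamma (3 / 2) ^ 2 / ‖Complex.Gamma (((3 / 2 : ℝ) : ℂ) + y * I)‖ ^ 2 with hQ3
  set Q := Real.Gamma (1 / 4) ^ 2 / ‖Complex.Gamma (((1 / 4 : ℝ) : ℂ) + y * I)‖ ^ 2 with hQ
  have hsec := Literature.Analysis.SpecialFunctions.GammaVert.log_gammaRatio_ge y (x := 1 / 4) (by norm_num) (by norm_num)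
  rw [← hQ1, ← hQ3, ← hQ] at hsec
  have hQ1v : Q1 = Real.sinh (π * y) / (π * y) := Literature.Analysis.SpecialFunctions.GammaVert.gammaRatio_one hyne
  have hQ3v : Q3 = Real.cosh (π * y) / (1 + 4 * y ^ 2) := Literature.Analysis.SpecialFunctions.GammaVert.gammaRatio_three_halves y
  have hQpos : 0 < Q := Literature.Analysis.SpecialFunctions.GammaVert.gammaRatio_pos (by norm_num) y
  have hΓpos : 0 < ‖Complex.Gamma (((1 / 4 : ℝ) : ℂ) + y * I)‖ :=
    norm_pos_iff.2 (Literature.Analysis.SpecialFunctions.GammaVert.Gamma_ne_zero_of_pos (by norm_num) y)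
  have hlogQ : 5 / 2 * Real.log Q1 - 3 / 2 * Real.log Q3 ≤ Real.log Q := by
    have : (3 - 2 * (1 / 4 : ℝ)) = 5 / 2 := by norm_num
    have h' : (2 - 2 * (1 / 4 : ℝ)) = 3 / 2 := by norm_num
    rw [this, h'] at hsec; exact hsec
  have hlogQ1 : π * y - Real.log (4 * π * y) ≤ Real.log Q1 := hQ1v ▸ log_sinh_div_ge hy
  have hlogQ3 : Real.log Q3 ≤ π * y - Real.log (4 * y ^ 2) := by
    rw [hQ3v, Real.log_div (Real.cosh_pos _).ne' (by positivity)]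
    have h1 := log_cosh_le hy0.le
    have h2 : Real.log (4 * y ^ 2) ≤ Real.log (1 + 4 * y ^ 2) :=
      Real.log_le_log (by positivity) (by linarith)
    linarith
  have hlog4πy : Real.log (4 * π * y) = Real.log (4 * π) + Real.log y :=
    Real.log_mul (by positivity) hyne
  have hlog4y2 : Real.log (4 * y ^ 2) = Real.log 4 + 2 * Real.log y := by
    rw [Real.log_mul (by norm_num) (by positivity), Real.log_pow]; push_cast; ring
  have hmain : Real.log (‖Complex.Gamma (((1 / 4 : ℝ) : ℂ) + y * I)‖ ^ 2) ≤
      Real.log (Real.Gamma (1 / 4) ^ 2) + 5 / 2 * Real.log (4 * π) - 3 / 2 * Real.log 4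
        + (-(1 / 2)) * Real.log y - π * y := by
    have e : Real.log (‖Complex.Gamma (((1 / 4 : ℝ) : ℂ) + y * I)‖ ^ 2) =
        Real.log (Real.Gamma (1 / 4) ^ 2) - Real.log Q := by
      rw [hQ, Real.log_div (by positivity) (by positivity)]; ring
    rw [e]; linarith
  have hΓ14 : 0 < Real.Gamma (1 / 4) := Real.Gamma_pos_of_pos (by norm_num)
  calc ‖Complex.Gamma (((1 / 4 : ℝ) : ℂ) + y * I)‖ ^ 2
      = Real.exp (Real.log (‖Complex.Gamma (((1 / 4 : ℝ) : ℂ) + y * I)‖ ^ 2)) :=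
        (Real.exp_log (by positivity)).symm
    _ ≤ Real.exp (Real.log (Real.Gamma (1 / 4) ^ 2) + 5 / 2 * Real.log (4 * π) -
          3 / 2 * Real.log 4 + (-(1 / 2)) * Real.log y - π * y) := Real.exp_le_exp.2 hmain
    _ = Real.Gamma (1 / 4) ^ 2 * (4 * π) ^ (5 / 2 : ℝ) * (4 : ℝ) ^ (-(3 / 2) : ℝ) *
          y ^ (-(1 / 2) : ℝ) * Real.exp (-(π * y)) := by
        rw [sub_eq_add_neg, sub_eq_add_neg, Real.exp_add, Real.exp_add, Real.exp_add, Real.exp_add,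
          Real.exp_log (by positivity), Real.rpow_def_of_pos (by positivity),
          Real.rpow_def_of_pos (by norm_num : (0 : ℝ) < 4), Real.rpow_def_of_pos hy0]
        have e1 : Real.exp (5 / 2 * Real.log (4 * π)) = Real.exp (Real.log (4 * π) * (5 / 2)) := by
          rw [mul_comm]
        have e2 : Real.exp (-(3 / 2 * Real.log 4)) = Real.exp (Real.log 4 * -(3 / 2)) := by
          congr 1; ring
        have e3 : Real.exp (-(1 / 2) * Real.log y) = Real.exp (Real.log y * -(1 / 2)) := by
          rw [mul_comm]
        rw [e1, e2, e3]
    _ ≤ Real.Gamma (1 / 4) ^ 2 * (4 * π) ^ (5 / 2 : ℝ) * y ^ (-(1 / 2) : ℝ) * Real.exp (-(π * y)) := by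
        have h4 : (4 : ℝ) ^ (-(3 / 2) : ℝ) ≤ 1 :=
          Real.rpow_le_one_of_one_le_of_nonpos (by norm_num) (by norm_num)
        have hpos : 0 ≤ Real.Gamma (1 / 4) ^ 2 * (4 * π) ^ (5 / 2 : ℝ) := by positivity
        have hpos2 : 0 ≤ y ^ (-(1 / 2) : ℝ) * Real.exp (-(π * y)) := by positivity
        calc _ = Real.Gamma (1 / 4) ^ 2 * (4 * π) ^ (5 / 2 : ℝ) * (4 : ℝ) ^ (-(3 / 2) : ℝ) *
              (y ^ (-(1 / 2) : ℝ) * Real.exp (-(π * y))) := by ring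
          _ ≤ Real.Gamma (1 / 4) ^ 2 * (4 * π) ^ (5 / 2 : ℝ) * 1 *
              (y ^ (-(1 / 2) : ℝ) * Real.exp (-(π * y))) := by gcongr
          _ = _ := by ring

/-- The sharp bounds in exponential-times-power form, both signs of `y`: there is `C` with
`‖Γ(5/4 + iy)‖ ≤ C |y|^{3/4} e^{-π|y|/2}` and `‖Γ(1/4 + iy)‖ ≤ C |y|^{-1/4} e^{-π|y|/2}` for
`|y| ≥ 1`. [folklore] -/
theorem exists_norm_Gamma_quarter_lines_le :
    ∃ C : ℝ, 0 < C ∧ ∀ y : ℝ, 1 ≤ |y| →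
      ‖Complex.Gamma ((5 / 4 : ℝ) + y * I)‖ ≤ C * |y| ^ (3 / 4 : ℝ) * Real.exp (-(π * |y| / 2)) ∧
      ‖Complex.Gamma ((1 / 4 : ℝ) + y * I)‖ ≤ C * |y| ^ (-(1 / 4) : ℝ) * Real.exp (-(π * |y| / 2)) := by
  set A : ℝ := Real.Gamma (5 / 4) ^ 2 * (4 * π) ^ (3 / 2 : ℝ) with hA
  set B : ℝ := Real.Gamma (1 / 4) ^ 2 * (4 * π) ^ (5 / 2 : ℝ) with hB
  have hA0 : 0 < A := by positivity
  have hB0 : 0 < B := by positivity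
  refine ⟨Real.sqrt A + Real.sqrt B, by positivity, fun y hy ↦ ?_⟩
  -- reduce to `y ≥ 1` by evenness
  have key : ∀ u : ℝ, 1 ≤ u →
      ‖Complex.Gamma ((5 / 4 : ℝ) + u * I)‖ ≤ Real.sqrt A * u ^ (3 / 4 : ℝ) * Real.exp (-(π * u / 2)) ∧
      ‖Complex.Gamma ((1 / 4 : ℝ) + u * I)‖ ≤ Real.sqrt B * u ^ (-(1 / 4) : ℝ) * Real.exp (-(π * u / 2)) := by
    intro u hu
    have hu0 : 0 < u := by linarith
    have e1 : (Real.sqrt A * u ^ (3 / 4 : ℝ) * Real.exp (-(π * u / 2))) ^ 2 =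
        A * u ^ (3 / 2 : ℝ) * Real.exp (-(π * u)) := by
      rw [mul_pow, mul_pow, Real.sq_sqrt hA0.le, ← Real.exp_nat_mul, ← Real.rpow_natCast,
        ← Real.rpow_mul hu0.le]
      push_cast; ring_nf
    have e2 : (Real.sqrt B * u ^ (-(1 / 4) : ℝ) * Real.exp (-(π * u / 2))) ^ 2 =
        B * u ^ (-(1 / 2) : ℝ) * Real.exp (-(π * u)) := by
      rw [mul_pow, mul_pow, Real.sq_sqrt hB0.le, ← Real.exp_nat_mul, ← Real.rpow_natCast,
        ← Real.rpow_mul hu0.le]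
      push_cast; ring_nf
    constructor
    · refine le_of_sq_le_sq ?_ (by positivity)
      rw [e1]; exact norm_sq_Gamma_five_quarters_le_of_one_le hu
    · refine le_of_sq_le_sq ?_ (by positivity)
      rw [e2]; exact norm_sq_Gamma_quarter_le_of_one_le hu
  have hmono : ∀ {a b c : ℝ}, 0 ≤ b → 0 ≤ c → a ≤ b * c → a ≤ (b + Real.sqrt B) * c :=
    fun hb hc h ↦ h.trans (by nlinarith [Real.sqrt_nonneg B])
  have hmono' : ∀ {a b c : ℝ}, 0 ≤ b → 0 ≤ c → a ≤ b * c → a ≤ (Real.sqrt A + b) * c :=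
    fun hb hc h ↦ h.trans (by nlinarith [Real.sqrt_nonneg A])
  rcases le_or_gt 0 y with hy0 | hy0
  · rw [abs_of_nonneg hy0] at hy ⊢
    obtain ⟨h1, h2⟩ := key y hy
    exact ⟨by rw [mul_assoc] at h1 ⊢; exact hmono (by positivity) (by positivity) h1,
      by rw [mul_assoc] at h2 ⊢; exact hmono' (by positivity) (by positivity) h2⟩
  · rw [abs_of_neg hy0] at hy ⊢
    obtain ⟨h1, h2⟩ := key (-y) hy
    rw [show ((-y : ℝ) : ℂ) * I = ((- -(-y) : ℝ) : ℂ) * I by simp] at h1 h2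
    rw [norm_Gamma_ofReal_sub] at h1 h2
    rw [show ((-(-y) : ℝ) : ℂ) = ((y : ℝ) : ℂ) by push_cast; ring] at h1 h2
    exact ⟨by rw [mul_assoc] at h1 ⊢; exact hmono (by positivity) (by positivity) h1,
      by rw [mul_assoc] at h2 ⊢; exact hmono' (by positivity) (by positivity) h2⟩


/-! ### The factor `F(s) = 2 (2π)^{-s} Γ(s) cos(πs/2)` of the functional equation `ζ(1−s) = F(s) ζ(s)` -/

/-- The factor of the (unsymmetric) functional equation `ζ(1 − s) = F(s) ζ(s)`,
`F(s) = 2 (2π)^{-s} Γ(s) cos(πs/2)` (Mathlib `riemannZeta_one_sub`; Titchmarsh (2.1.8): in the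
notation `ζ(s) = χ(s) ζ(1−s)`, `χ(s) = F(1−s)`). [folklore] -/
def feFactor (s : ℂ) : ℂ := 2 * (2 * (π : ℂ)) ^ (-s) * Complex.Gamma s * Complex.cos (π * s / 2)

/-- **The functional equation** in the form `ζ(z) = F(1 − z) ζ(1 − z)` (`z ≠ 0`, `z ∉ 1 + ℕ`).
[folklore] -/
theorem riemannZeta_eq_feFactor_mul {z : ℂ} (hz : ∀ n : ℕ, z ≠ 1 + n) (hz0 : z ≠ 0) :
    riemannZeta z = feFactor (1 - z) * riemannZeta (1 - z) := by
  have h := riemannZeta_one_sub (s := 1 - z) (fun n hn ↦ hz n (by linear_combination -hn))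
    (by intro h; apply hz0; linear_combination -h)
  rw [sub_sub_cancel] at h
  rw [h, feFactor]

/-- `‖(2π)^{-s}‖ = (2π)^{-re s}`. [folklore] -/
theorem norm_two_pi_cpow_neg (s : ℂ) : ‖(2 * (π : ℂ)) ^ (-s)‖ = (2 * π) ^ (-s.re) := by
  rw [show (2 * (π : ℂ)) = ((2 * π : ℝ) : ℂ) by push_cast; ring,
    Complex.norm_cpow_eq_rpow_re_of_pos (by positivity), neg_re]

/-- `‖cos(π s/2)‖ ≤ e^{π|im s|/2}`. [folklore] -/
theorem norm_cos_pi_mul_div_two_le (s : ℂ) :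
    ‖Complex.cos (π * s / 2)‖ ≤ Real.exp (π * |s.im| / 2) := by
  refine (Literature.Analysis.SpecialFunctions.GammaVert.norm_cos_le_cosh_im _).trans ?_
  have him : (π * s / 2 : ℂ).im = π * s.im / 2 := by
    simp [mul_im, div_ofNat_im]
  rw [him, Real.cosh_eq]
  have h1 : Real.exp (π * s.im / 2) ≤ Real.exp (π * |s.im| / 2) :=
    Real.exp_le_exp.2 (by nlinarith [le_abs_self s.im, Real.pi_pos])
  have h2 : Real.exp (-(π * s.im / 2)) ≤ Real.exp (π * |s.im| / 2) :=
    Real.exp_le_exp.2 (by nlinarith [neg_abs_le s.im, Real.pi_pos])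
  linarith

/-- The general shape of the bound: `‖F(x+iy)‖ ≤ 2 (2π)^{-x} ‖Γ(x+iy)‖ e^{π|y|/2}`. [folklore] -/
theorem norm_feFactor_le (x y : ℝ) :
    ‖feFactor (x + y * I)‖ ≤
      2 * (2 * π) ^ (-x) * ‖Complex.Gamma (x + y * I)‖ * Real.exp (π * |y| / 2) := by
  unfold feFactor
  rw [norm_mul, norm_mul, norm_mul, Complex.norm_ofNat, norm_two_pi_cpow_neg]
  have hre : ((x : ℂ) + y * I).re = x := by simp
  have him : ((x : ℂ) + y * I).im = y := by simp
  rw [hre]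
  have hc := norm_cos_pi_mul_div_two_le ((x : ℂ) + y * I)
  rw [him] at hc
  have h0 : 0 ≤ 2 * (2 * π) ^ (-x) * ‖Complex.Gamma (x + y * I)‖ := by positivity
  exact mul_le_mul_of_nonneg_left hc h0

/-- `Γ(x) ≤ Γ(1/4)` for `1/4 ≤ x ≤ 5/4` (convexity, `Γ(5/4) = Γ(1/4)/4`). [folklore] -/
theorem Real_Gamma_le_Gamma_quarter {x : ℝ} (h1 : 1 / 4 ≤ x) (h2 : x ≤ 5 / 4) :
    Real.Gamma x ≤ Real.Gamma (1 / 4) := by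
  have hconv := Real.convexOn_Gamma
  have h54 : Real.Gamma (5 / 4) ≤ Real.Gamma (1 / 4) := by
    rw [show (5 / 4 : ℝ) = 1 / 4 + 1 by norm_num, Real.Gamma_add_one (by norm_num)]
    have := Real.Gamma_pos_of_pos (by norm_num : (0 : ℝ) < 1 / 4)
    linarith
  have hmem : x ∈ segment ℝ (1 / 4 : ℝ) (5 / 4) := by
    rw [segment_eq_Icc (by norm_num)]; exact ⟨h1, h2⟩
  have := hconv.le_max_of_mem_segment (by norm_num : (1 / 4 : ℝ) ∈ Set.Ioi 0)
    (by norm_num : (5 / 4 : ℝ) ∈ Set.Ioi 0) hmem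
  exact this.trans (max_le le_rfl h54)

/-- **`F` on the line `re = 5/4`**: `‖F(5/4 + iy)‖ ≤ C (1 + |y|)^{3/4}`. [folklore] -/
theorem exists_norm_feFactor_five_quarters_le :
    ∃ C : ℝ, 0 < C ∧ ∀ y : ℝ, ‖feFactor ((5 / 4 : ℝ) + y * I)‖ ≤ C * (1 + |y|) ^ (3 / 4 : ℝ) := by
  obtain ⟨C₁, hC₁, hΓ⟩ := exists_norm_Gamma_quarter_lines_le
  have hπ := Real.pi_gt_three
  set K : ℝ := 2 * (2 * π) ^ (-(5 / 4 : ℝ)) with hK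
  have hK0 : 0 < K := by positivity
  refine ⟨K * (C₁ + Real.Gamma (5 / 4) * Real.exp (π / 2)), by positivity, fun y ↦ ?_⟩
  have hmain := norm_feFactor_le (5 / 4) y
  have h1y : (1 : ℝ) ≤ (1 + |y|) ^ (3 / 4 : ℝ) := Real.one_le_rpow (by linarith [abs_nonneg y]) (by norm_num)
  have hΓ54 : 0 < Real.Gamma (5 / 4) := Real.Gamma_pos_of_pos (by norm_num)
  rcases le_or_gt 1 |y| with hy | hy
  · obtain ⟨h54, -⟩ := hΓ y hy
    have hyy : |y| ^ (3 / 4 : ℝ) ≤ (1 + |y|) ^ (3 / 4 : ℝ) :=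
      Real.rpow_le_rpow (abs_nonneg y) (by linarith) (by norm_num)
    calc ‖feFactor ((5 / 4 : ℝ) + y * I)‖
        ≤ K * ‖Complex.Gamma ((5 / 4 : ℝ) + y * I)‖ * Real.exp (π * |y| / 2) := hmain
      _ ≤ K * (C₁ * |y| ^ (3 / 4 : ℝ) * Real.exp (-(π * |y| / 2))) * Real.exp (π * |y| / 2) := by
          gcongr
      _ = K * C₁ * |y| ^ (3 / 4 : ℝ) := by
          rw [show K * (C₁ * |y| ^ (3 / 4 : ℝ) * Real.exp (-(π * |y| / 2))) * Real.exp (π * |y| / 2) =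
            K * C₁ * |y| ^ (3 / 4 : ℝ) * (Real.exp (-(π * |y| / 2)) * Real.exp (π * |y| / 2)) by ring,
            ← Real.exp_add, neg_add_cancel, Real.exp_zero, mul_one]
      _ ≤ K * C₁ * (1 + |y|) ^ (3 / 4 : ℝ) := by gcongr
      _ ≤ K * (C₁ + Real.Gamma (5 / 4) * Real.exp (π / 2)) * (1 + |y|) ^ (3 / 4 : ℝ) := by
          gcongr; nlinarith [Real.exp_pos (π / 2)]
  · have hΓle : ‖Complex.Gamma ((5 / 4 : ℝ) + y * I)‖ ≤ Real.Gamma (5 / 4) :=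
      Literature.Analysis.SpecialFunctions.GammaVert.norm_Gamma_le_Gamma_re (by norm_num) y
    have hexp : Real.exp (π * |y| / 2) ≤ Real.exp (π / 2) :=
      Real.exp_le_exp.2 (by nlinarith [abs_nonneg y])
    calc ‖feFactor ((5 / 4 : ℝ) + y * I)‖
        ≤ K * ‖Complex.Gamma ((5 / 4 : ℝ) + y * I)‖ * Real.exp (π * |y| / 2) := hmain
      _ ≤ K * Real.Gamma (5 / 4) * Real.exp (π / 2) := by gcongr
      _ = K * (Real.Gamma (5 / 4) * Real.exp (π / 2)) * 1 := by ring
      _ ≤ K * (C₁ + Real.Gamma (5 / 4) * Real.exp (π / 2)) * (1 + |y|) ^ (3 / 4 : ℝ) := by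
          gcongr; linarith

/-- **`F` on the line `re = 1/4`**: `‖F(1/4 + iy)‖ ≤ C (1 + |y|)^{-1/4}`. [folklore] -/
theorem exists_norm_feFactor_quarter_le :
    ∃ C : ℝ, 0 < C ∧ ∀ y : ℝ, ‖feFactor ((1 / 4 : ℝ) + y * I)‖ ≤ C * (1 + |y|) ^ (-(1 / 4) : ℝ) := by
  obtain ⟨C₁, hC₁, hΓ⟩ := exists_norm_Gamma_quarter_lines_le
  have hπ := Real.pi_gt_three
  set K : ℝ := 2 * (2 * π) ^ (-(1 / 4 : ℝ)) with hK
  have hK0 : 0 < K := by positivity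
  have hΓ14 : 0 < Real.Gamma (1 / 4) := Real.Gamma_pos_of_pos (by norm_num)
  refine ⟨K * (C₁ + Real.Gamma (1 / 4) * Real.exp (π / 2)) * 2, by positivity, fun y ↦ ?_⟩
  have hmain := norm_feFactor_le (1 / 4) y
  -- `(1+|y|)^{-1/4} ≥ (2 max(1,|y|))^{-1/4} ≥ max(1,|y|)^{-1/4} / 2`
  rcases le_or_gt 1 |y| with hy | hy
  · obtain ⟨-, h14⟩ := hΓ y hy
    have hy0 : 0 < |y| := by linarith
    have hyy : |y| ^ (-(1 / 4) : ℝ) ≤ 2 * (1 + |y|) ^ (-(1 / 4) : ℝ) := by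
      have h2 : (1 + |y|) ^ (-(1 / 4) : ℝ) ≥ (2 * |y|) ^ (-(1 / 4) : ℝ) :=
        Real.rpow_le_rpow_of_nonpos (by positivity) (by linarith) (by norm_num)
      have h3 : (2 * |y|) ^ (-(1 / 4) : ℝ) = 2 ^ (-(1 / 4) : ℝ) * |y| ^ (-(1 / 4) : ℝ) :=
        Real.mul_rpow (by norm_num) hy0.le
      have h4 : (1 / 2 : ℝ) ≤ 2 ^ (-(1 / 4) : ℝ) := by
        rw [Real.rpow_neg (by norm_num), ← Real.inv_rpow (by norm_num)]
        calc (1 / 2 : ℝ) = (2⁻¹) ^ (1 : ℝ) := by norm_num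
          _ ≤ (2⁻¹ : ℝ) ^ (1 / 4 : ℝ) :=
              Real.rpow_le_rpow_of_exponent_ge (by norm_num) (by norm_num) (by norm_num)
      have h5 : 0 ≤ |y| ^ (-(1 / 4) : ℝ) := by positivity
      nlinarith
    calc ‖feFactor ((1 / 4 : ℝ) + y * I)‖
        ≤ K * ‖Complex.Gamma ((1 / 4 : ℝ) + y * I)‖ * Real.exp (π * |y| / 2) := hmain
      _ ≤ K * (C₁ * |y| ^ (-(1 / 4) : ℝ) * Real.exp (-(π * |y| / 2))) * Real.exp (π * |y| / 2) := by
          gcongr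
      _ = K * C₁ * |y| ^ (-(1 / 4) : ℝ) := by
          rw [show K * (C₁ * |y| ^ (-(1 / 4) : ℝ) * Real.exp (-(π * |y| / 2))) * Real.exp (π * |y| / 2) =
            K * C₁ * |y| ^ (-(1 / 4) : ℝ) * (Real.exp (-(π * |y| / 2)) * Real.exp (π * |y| / 2)) by ring,
            ← Real.exp_add, neg_add_cancel, Real.exp_zero, mul_one]
      _ ≤ K * C₁ * (2 * (1 + |y|) ^ (-(1 / 4) : ℝ)) := by gcongr
      _ ≤ K * (C₁ + Real.Gamma (1 / 4) * Real.exp (π / 2)) * 2 * (1 + |y|) ^ (-(1 / 4) : ℝ) := by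
          have h0 : 0 ≤ (1 + |y|) ^ (-(1 / 4) : ℝ) := by positivity
          have h1 : K * C₁ ≤ K * (C₁ + Real.Gamma (1 / 4) * Real.exp (π / 2)) := by
            have : 0 ≤ Real.Gamma (1 / 4) * Real.exp (π / 2) := by positivity
            nlinarith
          calc K * C₁ * (2 * (1 + |y|) ^ (-(1 / 4) : ℝ)) = K * C₁ * 2 * (1 + |y|) ^ (-(1 / 4) : ℝ) := by
                ring
            _ ≤ _ := by gcongr
  · have hΓle : ‖Complex.Gamma ((1 / 4 : ℝ) + y * I)‖ ≤ Real.Gamma (1 / 4) :=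
      Literature.Analysis.SpecialFunctions.GammaVert.norm_Gamma_le_Gamma_re (by norm_num) y
    have hexp : Real.exp (π * |y| / 2) ≤ Real.exp (π / 2) :=
      Real.exp_le_exp.2 (by nlinarith [abs_nonneg y])
    have hlow : (1 / 2 : ℝ) ≤ (1 + |y|) ^ (-(1 / 4) : ℝ) := by
      have h2 : (2 : ℝ) ^ (-(1 / 4) : ℝ) ≤ (1 + |y|) ^ (-(1 / 4) : ℝ) :=
        Real.rpow_le_rpow_of_nonpos (by positivity) (by linarith) (by norm_num)
      have h4 : (1 / 2 : ℝ) ≤ 2 ^ (-(1 / 4) : ℝ) := by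
        rw [Real.rpow_neg (by norm_num), ← Real.inv_rpow (by norm_num)]
        calc (1 / 2 : ℝ) = (2⁻¹) ^ (1 : ℝ) := by norm_num
          _ ≤ (2⁻¹ : ℝ) ^ (1 / 4 : ℝ) :=
              Real.rpow_le_rpow_of_exponent_ge (by norm_num) (by norm_num) (by norm_num)
      linarith
    calc ‖feFactor ((1 / 4 : ℝ) + y * I)‖
        ≤ K * ‖Complex.Gamma ((1 / 4 : ℝ) + y * I)‖ * Real.exp (π * |y| / 2) := hmain
      _ ≤ K * Real.Gamma (1 / 4) * Real.exp (π / 2) := by gcongr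
      _ = K * (Real.Gamma (1 / 4) * Real.exp (π / 2)) * 2 * (1 / 2) := by ring
      _ ≤ K * (C₁ + Real.Gamma (1 / 4) * Real.exp (π / 2)) * 2 * (1 + |y|) ^ (-(1 / 4) : ℝ) := by
          gcongr; linarith

/-- **`F` on the critical line**: `‖F(1/2 + iy)‖ ≤ 8π²` (the tree's `GammaVert.norm_fe_factor_le`).
[folklore] -/
theorem norm_feFactor_half_le (y : ℝ) : ‖feFactor (1 / 2 + y * I)‖ ≤ 8 * π ^ 2 := by
  have h := Literature.Analysis.SpecialFunctions.GammaVert.norm_fe_factor_le (s := 1 / 2 + y * I) (by simp) (by simp; norm_num)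
  have hre : (1 / 2 + y * I : ℂ).re - 1 / 2 = 0 := by simp
  rw [hre, Real.rpow_zero, mul_one] at h
  exact h

/-- **Crude bound on the strip `1/4 ≤ re ≤ 5/4`**: `‖F(x + iy)‖ ≤ 6 Γ(1/4) e^{π/2} (1 + |y|)²`.
[folklore] -/
theorem norm_feFactor_strip_le {x : ℝ} (h1 : 1 / 4 ≤ x) (h2 : x ≤ 5 / 4) (y : ℝ) :
    ‖feFactor (x + y * I)‖ ≤ 6 * Real.Gamma (1 / 4) * Real.exp (π / 2) * (1 + |y|) ^ 2 := by
  have hπ := Real.pi_gt_three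
  have hmain := norm_feFactor_le x y
  have hΓ14 : 0 < Real.Gamma (1 / 4) := Real.Gamma_pos_of_pos (by norm_num)
  have hK : 2 * (2 * π) ^ (-x) ≤ 2 := by
    have : (2 * π) ^ (-x) ≤ 1 := Real.rpow_le_one_of_one_le_of_nonpos (by linarith) (by linarith)
    linarith
  have hK0 : 0 ≤ 2 * (2 * π) ^ (-x) := by positivity
  -- `Γ(1/4) ≥ 3` (from `Γ(1/4) = 4 Γ(5/4) ≥ 4 · (1 - γ·?)`; we only need `Γ(1/4) ≥ 1`):
  have hΓ1 : 1 ≤ Real.Gamma (1 / 4) := by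
    -- `Γ(5/4) ≥ Γ(x_min) ≥ 0.88 > 1/4`, so `Γ(1/4) = 4Γ(5/4) ≥ 1`; via convexity and `Γ(1) = 1`,
    -- `Γ(2) = 1`: `Γ(5/4) ≥ 2Γ(1)·? ` — simplest: `Γ(1) ≤ max(Γ(1/4), Γ(5/4))` and `Γ(5/4) = Γ(1/4)/4`.
    have h := Real_Gamma_le_Gamma_quarter (x := 1) (by norm_num) (by norm_num)
    rwa [Real.Gamma_one] at h
  rcases le_or_gt 1 |y| with hy | hy
  · have hΓ := norm_Gamma_vertical_le (x := x) (by linarith) (by linarith) hy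
    calc ‖feFactor (x + y * I)‖
        ≤ 2 * (2 * π) ^ (-x) * ‖Complex.Gamma (x + y * I)‖ * Real.exp (π * |y| / 2) := hmain
      _ ≤ 2 * (3 * (1 + |y|) ^ 2 * Real.exp (-(π * |y| / 2))) * Real.exp (π * |y| / 2) := by
          gcongr
      _ = 6 * (1 + |y|) ^ 2 := by
          rw [show 2 * (3 * (1 + |y|) ^ 2 * Real.exp (-(π * |y| / 2))) * Real.exp (π * |y| / 2) =
            6 * (1 + |y|) ^ 2 * (Real.exp (-(π * |y| / 2)) * Real.exp (π * |y| / 2)) by ring,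
            ← Real.exp_add, neg_add_cancel, Real.exp_zero, mul_one]
      _ ≤ 6 * Real.Gamma (1 / 4) * Real.exp (π / 2) * (1 + |y|) ^ 2 := by
          have h1e : (1 : ℝ) ≤ Real.exp (π / 2) := Real.one_le_exp (by positivity)
          have h0 : 0 ≤ (1 + |y|) ^ 2 := by positivity
          have h6 : (6 : ℝ) ≤ 6 * Real.Gamma (1 / 4) * Real.exp (π / 2) := by
            have : (1 : ℝ) ≤ Real.Gamma (1 / 4) * Real.exp (π / 2) := by nlinarith
            nlinarith
          exact mul_le_mul_of_nonneg_right h6 h0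
  · have hΓle : ‖Complex.Gamma (x + y * I)‖ ≤ Real.Gamma (1 / 4) :=
      (Literature.Analysis.SpecialFunctions.GammaVert.norm_Gamma_le_Gamma_re (by linarith) y).trans (Real_Gamma_le_Gamma_quarter h1 h2)
    have hexp : Real.exp (π * |y| / 2) ≤ Real.exp (π / 2) :=
      Real.exp_le_exp.2 (by nlinarith [abs_nonneg y])
    calc ‖feFactor (x + y * I)‖
        ≤ 2 * (2 * π) ^ (-x) * ‖Complex.Gamma (x + y * I)‖ * Real.exp (π * |y| / 2) := hmain
      _ ≤ 2 * Real.Gamma (1 / 4) * Real.exp (π / 2) := by gcongr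
      _ = 2 * Real.Gamma (1 / 4) * Real.exp (π / 2) * 1 := by ring
      _ ≤ 6 * Real.Gamma (1 / 4) * Real.exp (π / 2) * (1 + |y|) ^ 2 := by
          have h1 : (1 : ℝ) ≤ (1 + |y|) ^ 2 := by nlinarith [abs_nonneg y]
          have h2 : 2 * Real.Gamma (1 / 4) * Real.exp (π / 2) ≤ 6 * Real.Gamma (1 / 4) * Real.exp (π / 2) := by
            nlinarith [Real.exp_pos (π / 2)]
          exact mul_le_mul h2 h1 zero_le_one (by positivity)

/-- `F` is differentiable away from the poles of `Γ`. [folklore] -/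
theorem differentiableAt_feFactor {s : ℂ} (hs : ∀ m : ℕ, s ≠ -m) : DifferentiableAt ℂ feFactor s := by
  unfold feFactor
  refine ((DifferentiableAt.mul (differentiableAt_const _) ?_).mul
    (Complex.differentiableAt_Gamma s hs)).mul ?_
  · refine DifferentiableAt.const_cpow differentiableAt_id.neg (Or.inl ?_)
    exact mul_ne_zero two_ne_zero (Complex.ofReal_ne_zero.2 Real.pi_pos.ne')
  · exact (((differentiableAt_const _).mul differentiableAt_id).div_const _).ccos

/-- `F` is differentiable on `re s > 0`. [folklore] -/
theorem differentiableOn_feFactor : DifferentiableOn ℂ feFactor {s : ℂ | 0 < s.re} := by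
  intro s hs
  refine (differentiableAt_feFactor fun m hm ↦ ?_).differentiableWithinAt
  rw [hm] at hs; simp at hs; linarith [Nat.cast_nonneg (α := ℝ) m]

/-- Peetre's inequality in the form used to make bounds uniform on a shell:
`1 + |a| ≤ (1 + |a + b|)(1 + |b|)`. [folklore] -/
theorem one_add_abs_le_mul (a b : ℝ) : 1 + |a| ≤ (1 + |a + b|) * (1 + |b|) := by
  have h := one_add_abs_add_le (a + b) (-b)
  rwa [add_neg_cancel_right, abs_neg] at h

end ZetaM4

end Literature.NumberTheory.LFunctions

end

noncomputable section

open Real Set Filter Topology Complex MeasureTheory Finset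
open scoped ComplexConjugate

namespace Literature.NumberTheory.LFunctions

namespace ZetaM4

open HuxleyZeroDetection
open MellinBarnes (continuous_Gamma_line integrable_Gamma_two_line norm_ofReal_cpow div_ofReal_cpow_neg)

/-! ## §2. The divisor coefficients `d(n)` and Mellin's formula with the kernels `Γ(w + k)` -/

/-- The divisor function as Dirichlet coefficients, `d = 1 ⋆ 1`. [folklore] -/
def dCoeff : ℕ → ℂ := LSeries.convolution 1 1

/-- `d(n) = #{divisors of n}` (also at `n = 0`, where both sides vanish). [folklore] -/
theorem dCoeff_apply (n : ℕ) : dCoeff n = (n.divisors.card : ℂ) := by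
  rw [dCoeff, LSeries.convolution_def]
  simp only [Pi.one_apply, mul_one]
  rw [Nat.sum_divisorsAntidiagonal (fun _ _ ↦ (1 : ℂ)), Finset.sum_const, nsmul_eq_mul, mul_one]

/-- `‖d(n)‖ = d(n)`. [folklore] -/
theorem norm_dCoeff (n : ℕ) : ‖dCoeff n‖ = (n.divisors.card : ℝ) := by
  rw [dCoeff_apply, Complex.norm_natCast]

/-- `d(n) ≤ n`. [folklore] -/
theorem norm_dCoeff_le_self (n : ℕ) : ‖dCoeff n‖ ≤ n := by
  rw [norm_dCoeff]; exact_mod_cast Nat.card_divisors_le_self n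

/-- `d(n) ≤ 1 · n` (the form consumed by the Mellin lemmas). [folklore] -/
theorem norm_dCoeff_le_one_mul (n : ℕ) : ‖dCoeff n‖ ≤ 1 * n := by
  rw [one_mul]; exact norm_dCoeff_le_self n

/-- **The divisor bound** `d(n) ≤ C_η n^η` (tree: `exists_card_divisors_le_mul_rpow`). [folklore] -/
theorem exists_norm_dCoeff_le_rpow {η : ℝ} (hη : 0 < η) :
    ∃ C : ℝ, 1 ≤ C ∧ ∀ n : ℕ, n ≠ 0 → ‖dCoeff n‖ ≤ C * (n : ℝ) ^ η := by
  obtain ⟨C, hC1, hC⟩ := Sieve.exists_card_divisors_le_mul_rpow hη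
  exact ⟨C, hC1, fun n hn ↦ by rw [norm_dCoeff]; exact hC n hn⟩

/-- **`L(d, s) = ζ(s)²` for `re s > 1`.** [folklore] -/
theorem LSeries_dCoeff {s : ℂ} (hs : 1 < s.re) : LSeries dCoeff s = riemannZeta s ^ 2 := by
  rw [dCoeff, LSeries_convolution' (LSeriesSummable_one_iff.2 hs) (LSeriesSummable_one_iff.2 hs),
    LSeries_one_eq_riemannZeta hs, sq]

/-! ### Mellin inversion for `x^k e^{-x}` at abscissa `2` -/

/-- `y ↦ Γ(c + iy)` is continuous for `c > 0`. [folklore] -/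
theorem continuous_Gamma_line_pos {c : ℝ} (hc : 0 < c) :
    Continuous fun y : ℝ ↦ Complex.Gamma (c + y * I) :=
  continuous_Gamma_line (σ := c) fun m h ↦ by
    have hm : (0 : ℝ) ≤ m := m.cast_nonneg; linarith

/-- `‖Γ(2 + k + iy)‖ ≤ 4^k (1+|y|)^k ‖Γ(2 + iy)‖` for `k ≤ 2`. [folklore] -/
theorem norm_Gamma_two_add_le {k : ℕ} (hk : k ≤ 2) (y : ℝ) :
    ‖Complex.Gamma (2 + y * I + k)‖ ≤ 4 ^ k * (1 + |y|) ^ k * ‖Complex.Gamma (2 + y * I)‖ := by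
  have hy1 : ∀ (a : ℝ), 0 ≤ a → a ≤ 2 → ‖(a : ℂ) + 2 + y * I‖ ≤ 4 * (1 + |y|) := by
    intro a ha0 ha2
    refine (norm_add_le _ _).trans ?_
    rw [show ((a : ℂ) + 2) = ((a + 2 : ℝ) : ℂ) by push_cast; ring, Complex.norm_real,
      norm_mul, Complex.norm_real, Complex.norm_I, mul_one, Real.norm_of_nonneg (by linarith),
      Real.norm_eq_abs]
    linarith [abs_nonneg y]
  interval_cases k
  · simp
  · have h2 : (2 + y * I : ℂ) ≠ 0 := by
      intro h; have := congrArg Complex.re h; simp at this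
    rw [Nat.cast_one, Complex.Gamma_add_one _ h2, norm_mul, pow_one, pow_one]
    gcongr
    simpa using hy1 0 le_rfl (by norm_num)
  · have h2 : (2 + y * I : ℂ) ≠ 0 := by
      intro h; have := congrArg Complex.re h; simp at this
    have h3 : (2 + y * I + 1 : ℂ) ≠ 0 := by
      intro h; have := congrArg Complex.re h; simp at this; linarith
    rw [Nat.cast_two, show (2 + y * I + 2 : ℂ) = (2 + y * I + 1) + 1 by ring,
      Complex.Gamma_add_one _ h3, Complex.Gamma_add_one _ h2, norm_mul, norm_mul]
    have e1 := hy1 1 (by norm_num) (by norm_num)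
    have e0 := hy1 0 le_rfl (by norm_num)
    rw [show ((1 : ℝ) : ℂ) + 2 + y * I = 2 + y * I + 1 by push_cast; ring] at e1
    rw [show ((0 : ℝ) : ℂ) + 2 + y * I = 2 + y * I by push_cast; ring] at e0
    have h0 : 0 ≤ ‖Complex.Gamma (2 + y * I)‖ := norm_nonneg _
    calc ‖2 + y * I + 1‖ * (‖2 + y * I‖ * ‖Complex.Gamma (2 + y * I)‖)
        ≤ (4 * (1 + |y|)) * ((4 * (1 + |y|)) * ‖Complex.Gamma (2 + y * I)‖) := by
          gcongr
      _ = 4 ^ 2 * (1 + |y|) ^ 2 * ‖Complex.Gamma (2 + y * I)‖ := by ring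

/-- A majorant: `‖Γ(2 + k + iy)‖ ≤ 48 e^{π/2} (1+|y|)^5 e^{-π|y|/2}` for `k ≤ 2`. [folklore] -/
theorem norm_Gamma_two_add_le_poly_exp {k : ℕ} (hk : k ≤ 2) (y : ℝ) :
    ‖Complex.Gamma (2 + y * I + k)‖ ≤
      48 * Real.exp (π / 2) * ((1 + |y|) ^ 5 * Real.exp (-(π * |y| / 2))) := by
  have h1 := norm_Gamma_two_add_le hk y
  have hy0 := abs_nonneg y
  have h1y : (1 : ℝ) ≤ 1 + |y| := by linarith
  have hypos : (0 : ℝ) < 1 + |y| := by linarith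
  have h3k : (4 : ℝ) ^ k * (1 + |y|) ^ k ≤ 16 * (1 + |y|) ^ 2 := by
    calc (4 : ℝ) ^ k * (1 + |y|) ^ k ≤ 4 ^ 2 * (1 + |y|) ^ 2 := by
          gcongr
          · norm_num
      _ = 16 * (1 + |y|) ^ 2 := by norm_num
  have h25 : (1 + |y|) ^ 2 ≤ (1 + |y|) ^ 5 := pow_le_pow_right₀ h1y (by norm_num)
  have h45 : (1 + |y|) ^ 4 ≤ (1 + |y|) ^ 5 := pow_le_pow_right₀ h1y (by norm_num)
  have h1e : (1 : ℝ) ≤ Real.exp (π / 2) := Real.one_le_exp (by positivity)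
  rcases le_or_gt 1 |y| with hy | hy
  · have hΓ := norm_Gamma_vertical_le (x := 2) (by norm_num) (by norm_num) hy
    rw [show (((2 : ℝ) : ℂ)) = 2 by norm_num] at hΓ
    have hE := Real.exp_pos (-(π * |y| / 2))
    calc ‖Complex.Gamma (2 + y * I + k)‖ ≤ 4 ^ k * (1 + |y|) ^ k * ‖Complex.Gamma (2 + y * I)‖ := h1
      _ ≤ 16 * (1 + |y|) ^ 2 * (3 * (1 + |y|) ^ 2 * Real.exp (-(π * |y| / 2))) := by gcongr
      _ = 48 * 1 * ((1 + |y|) ^ 4 * Real.exp (-(π * |y| / 2))) := by ring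
      _ ≤ 48 * Real.exp (π / 2) * ((1 + |y|) ^ 5 * Real.exp (-(π * |y| / 2))) := by
          gcongr
  · have hΓ : ‖Complex.Gamma (2 + y * I)‖ ≤ 1 := by
      have := Literature.Analysis.SpecialFunctions.GammaVert.norm_Gamma_le_Gamma_re (x := 2) (by norm_num) y
      rw [show (((2 : ℝ) : ℂ)) = 2 by norm_num, Real.Gamma_two] at this
      exact this
    have hexp : Real.exp (-(π / 2)) ≤ Real.exp (-(π * |y| / 2)) :=
      Real.exp_le_exp.2 (by nlinarith [Real.pi_pos])
    have hee : Real.exp (π / 2) * Real.exp (-(π / 2)) = 1 := by rw [← Real.exp_add]; simp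
    calc ‖Complex.Gamma (2 + y * I + k)‖ ≤ 4 ^ k * (1 + |y|) ^ k * ‖Complex.Gamma (2 + y * I)‖ := h1
      _ ≤ 16 * (1 + |y|) ^ 2 * 1 := by gcongr
      _ ≤ 48 * (1 + |y|) ^ 5 * 1 := by nlinarith [pow_pos hypos 2]
      _ = 48 * (1 + |y|) ^ 5 * (Real.exp (π / 2) * Real.exp (-(π / 2))) := by rw [hee]
      _ ≤ 48 * (1 + |y|) ^ 5 * (Real.exp (π / 2) * Real.exp (-(π * |y| / 2))) := by gcongr
      _ = _ := by ring

/-- `y ↦ Γ(2 + k + iy)` is integrable (`k ≤ 2`). [folklore] -/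
theorem integrable_Gamma_two_add_line {k : ℕ} (hk : k ≤ 2) :
    Integrable fun y : ℝ ↦ Complex.Gamma (2 + y * I + k) := by
  have hc : Continuous fun y : ℝ ↦ Complex.Gamma (2 + y * I + k) := by
    have := continuous_Gamma_line_pos (c := 2 + k) (by positivity)
    refine this.congr fun y ↦ ?_
    push_cast; ring_nf
  refine ((integrable_poly_exp.const_mul (48 * Real.exp (π / 2))).mono' hc.aestronglyMeasurable
    (Eventually.of_forall fun y ↦ ?_))
  exact norm_Gamma_two_add_le_poly_exp hk y

/-- **Mellin inversion for `x^k e^{-x}` at abscissa `2`:**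
`(2π)⁻¹ ∫ Γ(2 + k + iy) x^{-(2+iy)} dy = x^k e^{-x}` (`x > 0`, `k ≤ 2`). [folklore] -/
theorem mellinInv_Gamma_add_two {k : ℕ} (hk : k ≤ 2) {x : ℝ} (hx : 0 < x) :
    mellinInv 2 (fun w ↦ Complex.Gamma (w + k)) x = ((x ^ k * Real.exp (-x) : ℝ) : ℂ) := by
  set f₀ : ℝ → ℂ := fun t ↦ (Real.exp (-t) : ℂ) with hf₀
  set f : ℝ → ℂ := fun t ↦ (t : ℂ) ^ (k : ℂ) • f₀ t with hf
  have hmel₀ : mellin f₀ = Complex.GammaIntegral := Complex.GammaIntegral_eq_mellin.symm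
  have hmel : ∀ w : ℂ, 0 < w.re → mellin f w = Complex.Gamma (w + k) := by
    intro w hw
    rw [hf, mellin_cpow_smul, hmel₀, ← Complex.Gamma_eq_integral]
    simp only [add_re, natCast_re]; positivity
  have hline : ∀ y : ℝ, mellin f (((2 : ℝ) : ℂ) + y * I) = Complex.Gamma (((2 : ℝ) : ℂ) + y * I + k) :=
    fun y ↦ hmel _ (by simp)
  have h1 : mellinInv 2 (fun w ↦ Complex.Gamma (w + k)) x = mellinInv 2 (mellin f) x := by
    unfold mellinInv
    congr 1
    refine integral_congr_ae (Eventually.of_forall fun y ↦ ?_)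
    simp only
    rw [hline]
  rw [h1]
  have hfeq : f = fun t : ℝ ↦ (t : ℂ) ^ k * (Real.exp (-t) : ℂ) := by
    funext t
    simp only [hf, hf₀, smul_eq_mul, Complex.cpow_natCast]
  have hfx : f x = ((x ^ k * Real.exp (-x) : ℝ) : ℂ) := by
    rw [hfeq]; push_cast; ring
  rw [← hfx]
  refine mellinInv_mellin_eq 2 f hx ?_ ?_ ?_
  · -- `MellinConvergent f 2`
    rw [hf, MellinConvergent.cpow_smul]
    have h := Complex.GammaIntegral_convergent (s := 2 + (k : ℂ)) (by simp; positivity)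
    refine (h.congr_fun (fun t _ ↦ ?_) measurableSet_Ioi)
    simp [hf₀, smul_eq_mul, mul_comm]
  · -- `VerticalIntegrable (mellin f) 2`
    unfold Complex.VerticalIntegrable
    refine (integrable_Gamma_two_add_line hk).congr (Eventually.of_forall fun y ↦ ?_)
    have := hline y
    push_cast at this ⊢
    exact this.symm
  · -- continuity at `x`
    rw [hfeq]
    exact Continuous.continuousAt (by fun_prop)

/-- `∫ x^{-(2+iy)} Γ(2+k+iy) dy = 2π x^k e^{-x}` (`x > 0`, `k ≤ 2`). [folklore] -/
theorem integral_cpow_neg_mul_Gamma_add {k : ℕ} (hk : k ≤ 2) {x : ℝ} (hx : 0 < x) :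
    ∫ y : ℝ, (x : ℂ) ^ (-(2 + y * I)) * Complex.Gamma (2 + y * I + k) =
      2 * π * ((x ^ k * Real.exp (-x) : ℝ) : ℂ) := by
  have key : (∫ y : ℝ, (x : ℂ) ^ (-(2 + y * I)) * Complex.Gamma (2 + y * I + k)) =
      (2 * π : ℝ) • mellinInv 2 (fun w ↦ Complex.Gamma (w + k)) x := by
    unfold mellinInv
    rw [smul_smul, mul_one_div_cancel (by positivity : (2 * π : ℝ) ≠ 0), one_smul]
    refine integral_congr_ae (Eventually.of_forall fun y ↦ ?_)
    simp only [smul_eq_mul]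
    push_cast
    rfl
  rw [key, mellinInv_Gamma_add_two hk hx, Complex.real_smul]
  push_cast
  ring


/-! ### Mellin's formula on `re w = 2` with the kernels `Γ(w + k)` -/

section MellinK

variable {f : ℕ → ℂ} {C : ℝ}

/-- The coefficients `f(n) (n/Y)^k e^{-n/Y}`. [folklore] -/
def smoothedPow (k : ℕ) (f : ℕ → ℂ) (Y : ℝ) (n : ℕ) : ℂ :=
  f n * ((((n : ℝ) / Y) ^ k * Real.exp (-(n / Y)) : ℝ) : ℂ)

omit C in
/-- `smoothedPow 0 = smoothed`. [folklore] -/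
theorem smoothedPow_zero (f : ℕ → ℂ) (Y : ℝ) : smoothedPow 0 f Y = smoothed f Y := by
  funext n; simp [smoothedPow, smoothed]

omit C in
/-- `‖f(n) (n/Y)^k e^{-n/Y}‖ = ‖f n‖ (n/Y)^k e^{-n/Y}`. [folklore] -/
theorem norm_smoothedPow (k : ℕ) (f : ℕ → ℂ) {Y : ℝ} (hY : 0 < Y) (n : ℕ) :
    ‖smoothedPow k f Y n‖ = ‖f n‖ * (((n : ℝ) / Y) ^ k * Real.exp (-(n / Y))) := by
  unfold smoothedPow
  rw [norm_mul, Complex.norm_real, Real.norm_of_nonneg (by positivity)]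

/-- The termwise integrands `Γ(2+k+iy) Y^{2+iy} f(n) n^{-(s+2+iy)}` are continuous in `y`.
[folklore] -/
theorem continuous_mellinTermK (k : ℕ) {Y : ℝ} (hY : 0 < Y) (s : ℂ) (n : ℕ) :
    Continuous fun y : ℝ ↦ Complex.Gamma (2 + y * I + k) * (Y : ℂ) ^ (2 + y * I) *
      LSeries.term f (s + (2 + y * I)) n := by
  have hΓ : Continuous fun y : ℝ ↦ Complex.Gamma (2 + y * I + k) := by
    have := continuous_Gamma_line_pos (c := 2 + k) (by positivity)
    refine this.congr fun y ↦ ?_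
    push_cast; ring_nf
  have hX' : Continuous fun y : ℝ ↦ (Y : ℂ) ^ (2 + y * I) :=
    Continuous.const_cpow (by fun_prop) (Or.inl (ofReal_ne_zero.2 hY.ne'))
  rcases eq_or_ne n 0 with rfl | hn
  · simp only [LSeries.term_zero, mul_zero]; exact continuous_const
  · have ht : Continuous fun y : ℝ ↦ LSeries.term f (s + (2 + y * I)) n := by
      simp only [LSeries.term_of_ne_zero hn]
      exact continuous_const.div (Continuous.const_cpow (by fun_prop)
        (Or.inl (Nat.cast_ne_zero.2 hn))) fun y ↦ (cpow_ne_zero_iff.2 (Or.inl (Nat.cast_ne_zero.2 hn)))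
    exact (hΓ.mul hX').mul ht

/-- Norm bound for the termwise integrands when `‖f n‖ ≤ C n`. [folklore] -/
theorem norm_mellinTermK_le (k : ℕ) (hf : ∀ n, ‖f n‖ ≤ C * n) {Y : ℝ} (hY : 0 < Y) (s : ℂ) (n : ℕ)
    (y : ℝ) :
    ‖Complex.Gamma (2 + y * I + k) * (Y : ℂ) ^ (2 + y * I) * LSeries.term f (s + (2 + y * I)) n‖ ≤
      Y ^ (2 : ℝ) * (C * (1 / (n : ℝ) ^ (s.re + 1))) * ‖Complex.Gamma (2 + y * I + k)‖ := by
  have hC : 0 ≤ C := by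
    have := (norm_nonneg (f 1)).trans (hf 1); simpa using this
  rw [norm_mul, norm_mul, norm_ofReal_cpow hY, LSeries.norm_term_eq]
  have hre : (2 + (y : ℂ) * I).re = 2 := by simp
  have hre' : (s + (2 + (y : ℂ) * I)).re = s.re + 2 := by simp
  rw [hre, hre']
  split_ifs with hn
  · subst hn
    simp only [mul_zero]
    positivity
  · have hn0 : 0 < (n : ℝ) := by exact_mod_cast Nat.pos_of_ne_zero hn
    have h1 : ‖f n‖ / (n : ℝ) ^ (s.re + 2) ≤ C * (1 / (n : ℝ) ^ (s.re + 1)) := by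
      have hpos : (n : ℝ) ^ (s.re + 1) ≠ 0 := by positivity
      have hsplit : (n : ℝ) ^ (s.re + 2) = (n : ℝ) ^ (s.re + 1) * n := by
        rw [show s.re + 2 = (s.re + 1) + 1 by ring, Real.rpow_add hn0, Real.rpow_one]
      rw [div_le_iff₀ (by positivity), hsplit]
      calc ‖f n‖ ≤ C * n := hf n
        _ = C * (1 / (n : ℝ) ^ (s.re + 1)) * ((n : ℝ) ^ (s.re + 1) * n) := by
            rw [one_div, mul_assoc, ← mul_assoc ((n : ℝ) ^ (s.re + 1))⁻¹, inv_mul_cancel₀ hpos,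
              one_mul]
    have h0 : 0 ≤ ‖Complex.Gamma (2 + y * I + k)‖ * Y ^ (2 : ℝ) := by positivity
    calc ‖Complex.Gamma (2 + y * I + k)‖ * Y ^ (2 : ℝ) * (‖f n‖ / (n : ℝ) ^ (s.re + 2))
        ≤ ‖Complex.Gamma (2 + y * I + k)‖ * Y ^ (2 : ℝ) * (C * (1 / (n : ℝ) ^ (s.re + 1))) :=
          mul_le_mul_of_nonneg_left h1 h0
      _ = _ := by ring

omit C in
/-- **Termwise Mellin–Barnes with kernel `Γ(w+k)`**: for `n ≥ 1`, `k ≤ 2`,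
`∫ Γ(2+k+iy) Y^{2+iy} f(n) n^{-(s+2+iy)} dy = 2π f(n) (n/Y)^k e^{-n/Y} n^{-s}`. [folklore] -/
theorem integral_mellinTermK {k : ℕ} (hk : k ≤ 2) {Y : ℝ} (hY : 0 < Y) (s : ℂ) {n : ℕ} (hn : n ≠ 0) :
    ∫ y : ℝ, Complex.Gamma (2 + y * I + k) * (Y : ℂ) ^ (2 + y * I) * LSeries.term f (s + (2 + y * I)) n =
      2 * π * LSeries.term (smoothedPow k f Y) s n := by
  have hn0 : (n : ℂ) ≠ 0 := Nat.cast_ne_zero.2 hn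
  have hpt : ∀ y : ℝ, Complex.Gamma (2 + y * I + k) * (Y : ℂ) ^ (2 + y * I) *
      LSeries.term f (s + (2 + y * I)) n =
      (f n / (n : ℂ) ^ s) * ((((n : ℝ) / Y : ℝ) : ℂ) ^ (-(2 + y * I)) * Complex.Gamma (2 + y * I + k)) := by
    intro y
    have e1 : (n : ℂ) ^ (s + (2 + y * I)) = (n : ℂ) ^ s * (n : ℂ) ^ (2 + y * I) :=
      cpow_add _ _ hn0
    have e2 : (((n : ℝ) / Y : ℝ) : ℂ) ^ (-(2 + y * I)) =
        ((n : ℂ) ^ (2 + y * I))⁻¹ * (Y : ℂ) ^ (2 + y * I) := by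
      rw [div_ofReal_cpow_neg (Nat.cast_nonneg n) hY, cpow_neg, ofReal_natCast]
    have h1 : (n : ℂ) ^ s ≠ 0 := cpow_ne_zero_iff.2 (Or.inl hn0)
    have h2 : (n : ℂ) ^ (2 + y * I) ≠ 0 := cpow_ne_zero_iff.2 (Or.inl hn0)
    rw [LSeries.term_of_ne_zero hn, e1, e2]
    field_simp
  simp_rw [hpt]
  rw [integral_const_mul, integral_cpow_neg_mul_Gamma_add hk (by positivity),
    LSeries.term_of_ne_zero hn]
  unfold smoothedPow
  have h1 : (n : ℂ) ^ s ≠ 0 := cpow_ne_zero_iff.2 (Or.inl hn0)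
  field_simp

/-- **Mellin's formula on `re w = 2` with kernel `Γ(w + k)`** (`k ≤ 2`): if `‖f n‖ ≤ C n`,
`Y > 0` and `re s > 0`, then
`∫ Γ(2+k+iy) Y^{2+iy} L(f, s+2+iy) dy = 2π ∑_n f(n) (n/Y)^k e^{-n/Y} n^{-s}`. [folklore] -/
theorem integral_GammaK_cpow_LSeries_two {k : ℕ} (hk : k ≤ 2) (hf : ∀ n, ‖f n‖ ≤ C * n) {Y : ℝ}
    (hY : 0 < Y) {s : ℂ} (hs : 0 < s.re) :
    ∫ y : ℝ, Complex.Gamma (2 + y * I + k) * (Y : ℂ) ^ (2 + y * I) * LSeries f (s + (2 + y * I)) =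
      2 * π * LSeries (smoothedPow k f Y) s := by
  set F : ℕ → ℝ → ℂ := fun n y ↦ Complex.Gamma (2 + y * I + k) * (Y : ℂ) ^ (2 + y * I) *
    LSeries.term f (s + (2 + y * I)) n with hF
  have hp : 1 < s.re + 1 := by linarith
  have hpt : ∀ y : ℝ, Complex.Gamma (2 + y * I + k) * (Y : ℂ) ^ (2 + y * I) *
      LSeries f (s + (2 + y * I)) = ∑' n, F n y := by
    intro y
    rw [LSeries, ← tsum_mul_left]
  have hIΓ := integrable_Gamma_two_add_line hk
  have hint : ∀ n, Integrable (F n) := fun n ↦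
    ((hIΓ.norm.const_mul (Y ^ (2 : ℝ) * (C * (1 / (n : ℝ) ^ (s.re + 1))))).mono'
      (continuous_mellinTermK k hY s n).aestronglyMeasurable
      (Eventually.of_forall fun y ↦ by simpa [hF, mul_assoc] using norm_mellinTermK_le k hf hY s n y))
  set LΓ : ℝ := ∫ y : ℝ, ‖Complex.Gamma (2 + y * I + k)‖ with hLΓ
  have hsum : Summable fun n ↦ ∫ y, ‖F n y‖ := by
    refine Summable.of_nonneg_of_le (fun n ↦ integral_nonneg fun y ↦ norm_nonneg _)
      (fun n ↦ ?_) (((Real.summable_one_div_nat_rpow.2 hp).mul_left (Y ^ (2 : ℝ) * C * LΓ)))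
    calc ∫ y, ‖F n y‖
        ≤ ∫ y : ℝ, Y ^ (2 : ℝ) * (C * (1 / (n : ℝ) ^ (s.re + 1))) * ‖Complex.Gamma (2 + y * I + k)‖ :=
          integral_mono (hint n).norm (hIΓ.norm.const_mul _) fun y ↦ norm_mellinTermK_le k hf hY s n y
      _ = Y ^ (2 : ℝ) * C * LΓ * (1 / (n : ℝ) ^ (s.re + 1)) := by
          rw [integral_const_mul, hLΓ]; ring
  have hval : ∀ n, ∫ y, F n y = 2 * π * LSeries.term (smoothedPow k f Y) s n := by
    intro n
    rcases eq_or_ne n 0 with rfl | hn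
    · simp [hF, LSeries.term_zero]
    · exact integral_mellinTermK hk hY s hn
  calc ∫ y : ℝ, Complex.Gamma (2 + y * I + k) * (Y : ℂ) ^ (2 + y * I) * LSeries f (s + (2 + y * I))
      = ∫ y : ℝ, ∑' n, F n y := integral_congr_ae (Eventually.of_forall hpt)
    _ = ∑' n, ∫ y, F n y := (integral_tsum_of_summable_integral_norm hint hsum).symm
    _ = ∑' n, 2 * π * LSeries.term (smoothedPow k f Y) s n := tsum_congr hval
    _ = 2 * π * LSeries (smoothedPow k f Y) s := by rw [tsum_mul_left, LSeries]

end MellinK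

end ZetaM4

end Literature.NumberTheory.LFunctions

end

noncomputable section

open Real Set Filter Topology Complex MeasureTheory Finset
open scoped ComplexConjugate

namespace Literature.NumberTheory.LFunctions

namespace ZetaM4

open HuxleyZeroDetection

/-! ## §3. Majorants: `(1+|y|)^m e^{-π|y|/2}`, `Γ` and `ζ₁ = (s−1)ζ` on strips -/

/-- `(1 + u)^m e^{-πu/2} ≤ (2m+2)^m e^{-u}` for `u ≥ 0`. [folklore] -/
theorem pow_mul_exp_le (m : ℕ) {u : ℝ} (hu : 0 ≤ u) :
    (1 + u) ^ m * Real.exp (-(π * u / 2)) ≤ (2 * m + 2) ^ m * Real.exp (-u) := by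
  have hπ := Real.pi_gt_three
  set M : ℝ := 2 * m + 2 with hM
  have hM0 : 0 < M := by positivity
  -- `1 + u ≤ M e^{u/M}`
  have h1 : 1 + u ≤ M * Real.exp (u / M) := by
    have := Real.add_one_le_exp (u / M)
    have hM1 : (1 : ℝ) ≤ M := by rw [hM]; linarith [(Nat.cast_nonneg m : (0 : ℝ) ≤ m)]
    calc 1 + u ≤ M * (u / M + 1) := by rw [mul_add, mul_div_cancel₀ _ hM0.ne']; nlinarith
      _ ≤ M * Real.exp (u / M) := by gcongr
  have h2 : (1 + u) ^ m ≤ M ^ m * Real.exp (u / 2) := by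
    calc (1 + u) ^ m ≤ (M * Real.exp (u / M)) ^ m := pow_le_pow_left₀ (by positivity) h1 m
      _ = M ^ m * Real.exp (m * (u / M)) := by rw [mul_pow, ← Real.exp_nat_mul]
      _ ≤ M ^ m * Real.exp (u / 2) := by
          gcongr
          rw [hM]
          have hm0 : (0 : ℝ) ≤ m := Nat.cast_nonneg m
          rw [mul_div_assoc']
          rw [div_le_div_iff₀ (by positivity) (by norm_num)]
          nlinarith
  calc (1 + u) ^ m * Real.exp (-(π * u / 2)) ≤ M ^ m * Real.exp (u / 2) * Real.exp (-(π * u / 2)) := by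
        gcongr
    _ = M ^ m * Real.exp (u / 2 + -(π * u / 2)) := by rw [Real.exp_add]; ring
    _ ≤ M ^ m * Real.exp (-u) := by gcongr; nlinarith
    _ = (2 * m + 2) ^ m * Real.exp (-u) := by rw [hM]

/-- `y ↦ (1+|y|)^m e^{-π|y|/2}` is integrable. [folklore] -/
theorem integrable_pow_mul_exp (m : ℕ) :
    Integrable fun y : ℝ ↦ (1 + |y|) ^ m * Real.exp (-(π * |y| / 2)) := by
  refine ((integrable_exp_neg_abs.const_mul ((2 * m + 2) ^ m)).mono' (by fun_prop)
    (Eventually.of_forall fun y ↦ ?_))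
  rw [Real.norm_of_nonneg (by positivity)]
  exact pow_mul_exp_le m (abs_nonneg y)

/-- `∫ (1+|y|)^m e^{-π|y|/2} dy ≤ 2 (2m+2)^m`. [folklore] -/
theorem integral_pow_mul_exp_le (m : ℕ) :
    ∫ y : ℝ, (1 + |y|) ^ m * Real.exp (-(π * |y| / 2)) ≤ 2 * (2 * m + 2) ^ m := by
  calc ∫ y : ℝ, (1 + |y|) ^ m * Real.exp (-(π * |y| / 2))
      ≤ ∫ y : ℝ, (2 * m + 2) ^ m * Real.exp (-|y|) :=
        integral_mono (integrable_pow_mul_exp m) (integrable_exp_neg_abs.const_mul _)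
          fun y ↦ pow_mul_exp_le m (abs_nonneg y)
    _ = 2 * (2 * m + 2) ^ m := by rw [integral_const_mul, integral_exp_neg_abs]; ring

/-- Threshold form of `K (1+|T|)^m e^{-π|T|/2} → 0`. [folklore] -/
theorem exists_pow_mul_exp_le (m : ℕ) {K ε : ℝ} (hK : 0 ≤ K) (hε : 0 < ε) :
    ∃ T₀ : ℝ, ∀ T : ℝ, T₀ ≤ |T| → K * ((1 + |T|) ^ m * Real.exp (-(π * |T| / 2))) ≤ ε := by
  have hlim : Tendsto (fun T : ℝ ↦ K * (2 * m + 2) ^ m * Real.exp (-T)) atTop (𝓝 0) := by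
    have := Real.tendsto_exp_neg_atTop_nhds_zero.const_mul (K * (2 * m + 2) ^ m)
    simpa using this
  obtain ⟨T₁, hT₁⟩ := eventually_atTop.1 (hlim.eventually (ge_mem_nhds hε))
  refine ⟨T₁, fun T hT ↦ ?_⟩
  calc K * ((1 + |T|) ^ m * Real.exp (-(π * |T| / 2))) ≤ K * ((2 * m + 2) ^ m * Real.exp (-|T|)) :=
        mul_le_mul_of_nonneg_left (pow_mul_exp_le m (abs_nonneg T)) hK
    _ = K * (2 * m + 2) ^ m * Real.exp (-|T|) := by ring
    _ ≤ ε := hT₁ _ hT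

/-- The constant in the strip bound for `Γ`. [folklore] -/
def CΓ : ℝ := 6 + (Real.Gamma (1 / 4) + 2) * Real.exp (π / 2)

/-- `C_Γ > 0`. [folklore] -/
theorem CΓ_pos : 0 < CΓ := by unfold CΓ; positivity

/-- `Γ(x) ≤ Γ(1/4) + 2` on `[1/4, 3]` (convexity; `Γ(3) = 2`). [folklore] -/
theorem Real_Gamma_le_strip {x : ℝ} (h1 : 1 / 4 ≤ x) (h2 : x ≤ 3) :
    Real.Gamma x ≤ Real.Gamma (1 / 4) + 2 := by
  have hconv := Real.convexOn_Gamma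
  have hmem : x ∈ segment ℝ (1 / 4 : ℝ) 3 := by
    rw [segment_eq_Icc (by norm_num)]; exact ⟨h1, h2⟩
  have := hconv.le_max_of_mem_segment (by norm_num : (1 / 4 : ℝ) ∈ Set.Ioi 0)
    (by norm_num : (3 : ℝ) ∈ Set.Ioi 0) hmem
  have h3 : Real.Gamma 3 = 2 := by
    rw [show (3 : ℝ) = 2 + 1 by norm_num, Real.Gamma_add_one (by norm_num), Real.Gamma_two]; norm_num
  rw [h3] at this
  have hpos := Real.Gamma_pos_of_pos (by norm_num : (0 : ℝ) < 1 / 4)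
  exact this.trans (max_le (by linarith) (by linarith))

/-- **`Γ` on the strip `1/4 ≤ re ≤ 3`**: `‖Γ(x + iy)‖ ≤ C_Γ (1+|y|)³ e^{-π|y|/2}`. [folklore] -/
theorem norm_Gamma_strip_le {x : ℝ} (h1 : 1 / 4 ≤ x) (h2 : x ≤ 3) (y : ℝ) :
    ‖Complex.Gamma (x + y * I)‖ ≤ CΓ * (1 + |y|) ^ 3 * Real.exp (-(π * |y| / 2)) := by
  have hy0 := abs_nonneg y
  have h1y : (1 : ℝ) ≤ 1 + |y| := by linarith
  have hE := Real.exp_pos (-(π * |y| / 2))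
  have hΓ14 : 0 < Real.Gamma (1 / 4) := Real.Gamma_pos_of_pos (by norm_num)
  rcases le_or_gt 1 |y| with hy | hy
  · -- `|y| ≥ 1`
    have hmain : ‖Complex.Gamma (x + y * I)‖ ≤ 6 * (1 + |y|) ^ 3 * Real.exp (-(π * |y| / 2)) := by
      rcases le_or_gt x (5 / 2) with hx | hx
      · have := norm_Gamma_vertical_le (x := x) (by linarith) hx hy
        calc ‖Complex.Gamma (x + y * I)‖ ≤ 3 * (1 + |y|) ^ 2 * Real.exp (-(π * |y| / 2)) := this
          _ ≤ 6 * (1 + |y|) ^ 3 * Real.exp (-(π * |y| / 2)) := by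
              have h23 : (1 + |y|) ^ 2 ≤ (1 + |y|) ^ 3 := pow_le_pow_right₀ h1y (by norm_num)
              have h0 : 0 ≤ (1 + |y|) ^ 2 := by positivity
              nlinarith
      · -- `x ∈ (5/2, 3]`: `Γ(x+iy) = (x-1+iy) Γ(x-1+iy)`
        have hne : ((x - 1 : ℝ) : ℂ) + y * I ≠ 0 := by
          intro h; have := congrArg Complex.re h; simp at this; linarith
        have e : (x : ℂ) + y * I = ((x - 1 : ℝ) : ℂ) + y * I + 1 := by push_cast; ring
        rw [e, Complex.Gamma_add_one _ hne, norm_mul]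
        have hΓ' := norm_Gamma_vertical_le (x := x - 1) (by linarith) (by linarith) hy
        have hn : ‖((x - 1 : ℝ) : ℂ) + y * I‖ ≤ 2 * (1 + |y|) := by
          refine (norm_add_le _ _).trans ?_
          rw [Complex.norm_real, norm_mul, Complex.norm_real, Complex.norm_I, mul_one,
            Real.norm_of_nonneg (by linarith), Real.norm_eq_abs]
          linarith
        calc ‖((x - 1 : ℝ) : ℂ) + y * I‖ * ‖Complex.Gamma (((x - 1 : ℝ) : ℂ) + y * I)‖
            ≤ (2 * (1 + |y|)) * (3 * (1 + |y|) ^ 2 * Real.exp (-(π * |y| / 2))) := by gcongr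
          _ = 6 * (1 + |y|) ^ 3 * Real.exp (-(π * |y| / 2)) := by ring
    refine hmain.trans ?_
    have : (6 : ℝ) ≤ CΓ := by
      unfold CΓ; have : 0 ≤ (Real.Gamma (1 / 4) + 2) * Real.exp (π / 2) := by positivity
      linarith
    gcongr
  · have hΓ : ‖Complex.Gamma (x + y * I)‖ ≤ Real.Gamma (1 / 4) + 2 :=
      (Literature.Analysis.SpecialFunctions.GammaVert.norm_Gamma_le_Gamma_re (by linarith) y).trans (Real_Gamma_le_strip h1 h2)
    have hexp : Real.exp (-(π / 2)) ≤ Real.exp (-(π * |y| / 2)) :=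
      Real.exp_le_exp.2 (by nlinarith [Real.pi_pos])
    have hee : Real.exp (π / 2) * Real.exp (-(π / 2)) = 1 := by rw [← Real.exp_add]; simp
    calc ‖Complex.Gamma (x + y * I)‖ ≤ (Real.Gamma (1 / 4) + 2) * 1 * 1 := by simpa using hΓ
      _ ≤ (Real.Gamma (1 / 4) + 2) * (1 + |y|) ^ 3 * (Real.exp (π / 2) * Real.exp (-(π / 2))) := by
          rw [hee]; gcongr; exact one_le_pow₀ h1y
      _ ≤ (Real.Gamma (1 / 4) + 2) * (1 + |y|) ^ 3 * (Real.exp (π / 2) * Real.exp (-(π * |y| / 2))) := by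
          gcongr
      _ = (Real.Gamma (1 / 4) + 2) * Real.exp (π / 2) * (1 + |y|) ^ 3 * Real.exp (-(π * |y| / 2)) := by
          ring
      _ ≤ CΓ * (1 + |y|) ^ 3 * Real.exp (-(π * |y| / 2)) := by
          gcongr; unfold CΓ; linarith

/-- **`ζ₁ = (s−1)ζ` in the strip** `-1/4 ≤ re z ≤ 5/2`, away from the pole (`‖z − 1‖ ≥ 1/2`):
`‖ζ₁(z)‖ ≤ 384 (1 + |im z|)⁴`. [folklore] -/
theorem norm_riemannZeta₁_le {z : ℂ} (h1 : -1 / 4 ≤ z.re) (h2 : z.re ≤ 5 / 2) (hz : 1 / 2 ≤ ‖z - 1‖) :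
    ‖riemannZeta₁ z‖ ≤ 384 * (1 + |z.im|) ^ 4 := by
  have hz1 : z ≠ 1 := by
    intro h; rw [h, sub_self, norm_zero] at hz; norm_num at hz
  rw [LFunctions.riemannZeta₁_eq_mul hz1, norm_mul]
  have hζ := norm_zeta_le_poly (s := z) (by linarith) (by linarith) hz
  have hn : ‖z - 1‖ ≤ 2 * (1 + |z.im|) := by
    have := Complex.norm_le_abs_re_add_abs_im (z - 1)
    simp only [sub_re, one_re, sub_im, one_im, sub_zero] at this
    have : |z.re - 1| ≤ 3 / 2 := abs_le.2 ⟨by linarith, by linarith⟩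
    linarith [abs_nonneg z.im]
  have h0 : 0 ≤ 1 + |z.im| := by positivity
  calc ‖z - 1‖ * ‖riemannZeta z‖ ≤ (2 * (1 + |z.im|)) * (192 * (1 + |z.im|) ^ 3) := by gcongr
    _ = 384 * (1 + |z.im|) ^ 4 := by ring

/-- On a vertical line through the strip, for `|im z| ≥ 1` the condition `‖z − 1‖ ≥ 1/2` holds.
[folklore] -/
theorem half_le_norm_sub_one_of_im {z : ℂ} (hz : 1 ≤ |z.im|) : 1 / 2 ≤ ‖z - 1‖ := by
  have := abs_im_le_norm (z - 1)
  simp only [sub_im, one_im, sub_zero] at this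
  linarith

/-- … and so does it when `|re z − 1| ≥ 1/2`. [folklore] -/
theorem half_le_norm_sub_one_of_re {z : ℂ} (hz : 1 / 2 ≤ |z.re - 1|) : 1 / 2 ≤ ‖z - 1‖ := by
  have := abs_re_le_norm (z - 1)
  simp only [sub_re, one_re] at this
  linarith

end ZetaM4

end Literature.NumberTheory.LFunctions

end

noncomputable section

open Real Set Filter Topology Complex MeasureTheory Finset
open scoped ComplexConjugate

namespace Literature.NumberTheory.LFunctions

namespace ZetaM4

open HuxleyZeroDetection
open MellinBarnes (norm_ofReal_cpow)

/-! ## §4. The integrand `F_s(w) = ζ₁(s+w)² Γ(w+1) X^w/(s−1)²` and the shift `re w = 2 → −3/4`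

With `ζ₁(z) = (z−1)ζ(z)` (entire) the function `F_s(w)/w` equals `ζ²(s+w) Γ(w) X^w (1 + w/(s−1))²`
and is holomorphic in `re w > −1` except for the simple pole at `w = 0` with residue `ζ²(s)`:
the factor `(s + w − 1)²` removes the double pole of `ζ²(s+w)` at `w = 1 − s`. -/

variable {s : ℂ} {X : ℝ}

/-- `F_s(w) = ζ₁(s+w)² Γ(w+1) X^w / (s−1)²`. [folklore] -/
def m4Num (s : ℂ) (X : ℝ) (w : ℂ) : ℂ :=
  riemannZeta₁ (s + w) ^ 2 * Complex.Gamma (w + 1) * (X : ℂ) ^ w / (s - 1) ^ 2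

/-- `F_s(0) = ζ(s)²`. [folklore] -/
theorem m4Num_zero (hs1 : s ≠ 1) (X : ℝ) : m4Num s X 0 = riemannZeta s ^ 2 := by
  unfold m4Num
  rw [add_zero, zero_add, Complex.Gamma_one, cpow_zero, mul_one, mul_one,
    LFunctions.riemannZeta₁_eq_mul hs1]
  have : s - 1 ≠ 0 := sub_ne_zero.2 hs1
  field_simp

/-- `F_s` is holomorphic on `re w > −1`. [folklore] -/
theorem differentiableOn_m4Num (s : ℂ) (hX : 0 < X) :
    DifferentiableOn ℂ (m4Num s X) {w : ℂ | -1 < w.re} := by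
  intro w hw
  refine DifferentiableAt.differentiableWithinAt ?_
  unfold m4Num
  refine (((DifferentiableAt.pow ?_ 2).mul ?_).mul ?_).div_const _
  · exact (differentiable_riemannZeta₁.comp ((differentiable_const s).add differentiable_id)) w
  · refine (Complex.differentiableAt_Gamma _ fun m hm ↦ ?_).comp w (differentiableAt_id.add_const 1)
    have := congrArg Complex.re hm
    simp at this
    have h0 : (0 : ℝ) ≤ m := Nat.cast_nonneg m
    simp only [Set.mem_setOf_eq] at hw
    linarith
  · exact differentiableAt_id.const_cpow (Or.inl (ofReal_ne_zero.2 hX.ne'))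

/-- `y ↦ F_s(c + iy)/(c + iy)` is continuous for `c > −1`, `c ≠ 0`. [folklore] -/
theorem continuous_m4Num_line (s : ℂ) (hX : 0 < X) {c : ℝ} (hc : -1 < c) (hc0 : c ≠ 0) :
    Continuous fun y : ℝ ↦ m4Num s X (c + y * I) / ((c : ℂ) + y * I) := by
  have hd := differentiableOn_m4Num s hX
  have hline : Continuous fun y : ℝ ↦ (c : ℂ) + y * I := by fun_prop
  refine (hd.continuousOn.comp_continuous hline fun y ↦ by simp [hc]).div hline fun y h ↦ hc0 ?_
  have := congrArg Complex.re h; simpa using this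

/-! ### The line `re w = 2`: Mellin -/

/-- On `w ≠ 0` with `s + w ≠ 1`:
`F_s(w)/w = X^w ζ(s+w)² (Γ(w) + c₁ Γ(w+1) + c₂ Γ(w+2))`, `c₁ = 2/(s−1) − 1/(s−1)²`,
`c₂ = 1/(s−1)²`. [folklore] -/
theorem m4Num_div_eq (hs1 : s ≠ 1) {w : ℂ} (hw : w ≠ 0) (hw1 : ∀ m : ℕ, w ≠ -m)
    (hsw : s + w ≠ 1) :
    m4Num s X w / w = (X : ℂ) ^ w * riemannZeta (s + w) ^ 2 *
      (Complex.Gamma w + (2 / (s - 1) - 1 / (s - 1) ^ 2) * Complex.Gamma (w + 1) +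
        1 / (s - 1) ^ 2 * Complex.Gamma (w + 2)) := by
  unfold m4Num
  have hG1 : Complex.Gamma (w + 1) = w * Complex.Gamma w := Complex.Gamma_add_one _ hw
  have hw1' : w + 1 ≠ 0 := by
    intro h; exact hw1 1 (by linear_combination h)
  have hG2 : Complex.Gamma (w + 2) = (w + 1) * (w * Complex.Gamma w) := by
    rw [show w + 2 = (w + 1) + 1 by ring, Complex.Gamma_add_one _ hw1', hG1]
  rw [hG1, hG2, LFunctions.riemannZeta₁_eq_mul hsw]
  have : s - 1 ≠ 0 := sub_ne_zero.2 hs1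
  field_simp
  ring

/-- The three Mellin integrands on `re w = 2` are integrable (`k ≤ 2`, `re s = 1/2`). [folklore] -/
theorem integrable_GammaK_zeta_sq_line {k : ℕ} (hk : k ≤ 2) (hs : s.re = 1 / 2) (hX : 0 < X) :
    Integrable fun y : ℝ ↦ Complex.Gamma (2 + y * I + k) * (X : ℂ) ^ (2 + y * I) *
      riemannZeta (s + (2 + y * I)) ^ 2 := by
  have hc : Continuous fun y : ℝ ↦ Complex.Gamma (2 + y * I + k) * (X : ℂ) ^ (2 + y * I) *
      riemannZeta (s + (2 + y * I)) ^ 2 := by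
    have hΓ : Continuous fun y : ℝ ↦ Complex.Gamma (2 + y * I + k) := by
      have := continuous_Gamma_line_pos (c := 2 + k) (by positivity)
      refine this.congr fun y ↦ ?_
      push_cast; ring_nf
    have hXc : Continuous fun y : ℝ ↦ (X : ℂ) ^ (2 + y * I) :=
      Continuous.const_cpow (by fun_prop) (Or.inl (ofReal_ne_zero.2 hX.ne'))
    have hζ : Continuous fun y : ℝ ↦ riemannZeta (s + (2 + y * I)) := by
      refine continuous_iff_continuousAt.2 fun y ↦ ?_
      have hne : s + (2 + y * I) ≠ 1 := by
        intro h; have := congrArg Complex.re h; norm_num [hs] at this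
      exact ContinuousAt.comp (f := fun y : ℝ ↦ s + (2 + y * I))
        (differentiableAt_riemannZeta hne).continuousAt
        (by fun_prop : Continuous fun y : ℝ ↦ s + (2 + y * I)).continuousAt
    exact (hΓ.mul hXc).mul (hζ.pow 2)
  refine (((integrable_Gamma_two_add_line hk).norm.mul_const (X ^ (2 : ℝ) * 4)).mono'
    hc.aestronglyMeasurable (Eventually.of_forall fun y ↦ ?_))
  rw [norm_mul, norm_mul, norm_ofReal_cpow hX, norm_pow]
  have hre : (2 + (y : ℂ) * I).re = 2 := by simp
  rw [hre]
  have hζ : ‖riemannZeta (s + (2 + y * I))‖ ≤ 2 := norm_zeta_le_two (by norm_num [hs])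
  have h0 : 0 ≤ ‖riemannZeta (s + (2 + y * I))‖ := norm_nonneg _
  calc ‖Complex.Gamma (2 + y * I + k)‖ * X ^ (2 : ℝ) * ‖riemannZeta (s + (2 + y * I))‖ ^ 2
      ≤ ‖Complex.Gamma (2 + y * I + k)‖ * X ^ (2 : ℝ) * 2 ^ 2 := by gcongr
    _ = _ := by ring

/-- The smoothed Dirichlet series side:
`E(s) = L(d e^{-·/X}, s) + c₁ L(d (·/X) e^{-·/X}, s) + c₂ L(d ((·/X)² e^{-·/X}), s)`. [folklore] -/
def Esum (s : ℂ) (X : ℝ) : ℂ :=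
  LSeries (smoothedPow 0 dCoeff X) s +
    (2 / (s - 1) - 1 / (s - 1) ^ 2) * LSeries (smoothedPow 1 dCoeff X) s +
    1 / (s - 1) ^ 2 * LSeries (smoothedPow 2 dCoeff X) s

/-- **Mellin on `re w = 2`:** `∫ F_s(2+iy)/(2+iy) dy = 2π E(s)` and the integrand is integrable
(`re s = 1/2`, `X > 0`). [folklore] -/
theorem integral_m4Num_two (hs : s.re = 1 / 2) (hX : 0 < X) :
    Integrable (fun y : ℝ ↦ m4Num s X (((2 : ℝ) : ℂ) + y * I) / (((2 : ℝ) : ℂ) + y * I - 0)) ∧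
    ∫ y : ℝ, m4Num s X (((2 : ℝ) : ℂ) + y * I) / (((2 : ℝ) : ℂ) + y * I - 0) = 2 * π * Esum s X := by
  have hs1 : s ≠ 1 := by intro h; rw [h] at hs; norm_num at hs
  have hs0 : 0 < s.re := by rw [hs]; norm_num
  set c₁ : ℂ := 2 / (s - 1) - 1 / (s - 1) ^ 2 with hc₁
  set c₂ : ℂ := 1 / (s - 1) ^ 2 with hc₂
  set G : ℕ → ℝ → ℂ := fun k y ↦ Complex.Gamma (2 + y * I + k) * (X : ℂ) ^ (2 + y * I) *
    riemannZeta (s + (2 + y * I)) ^ 2 with hG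
  have hpt : ∀ y : ℝ, m4Num s X (((2 : ℝ) : ℂ) + y * I) / (((2 : ℝ) : ℂ) + y * I - 0) =
      G 0 y + c₁ * G 1 y + c₂ * G 2 y := by
    intro y
    have hw : (((2 : ℝ) : ℂ) + y * I) ≠ 0 := by
      intro h; have := congrArg Complex.re h; simp at this
    have hw1 : ∀ m : ℕ, (((2 : ℝ) : ℂ) + y * I) ≠ -m := by
      intro m h; have := congrArg Complex.re h; simp at this
      linarith [(Nat.cast_nonneg m : (0 : ℝ) ≤ m)]
    have hsw : s + (((2 : ℝ) : ℂ) + y * I) ≠ 1 := by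
      intro h; have := congrArg Complex.re h; norm_num [hs] at this
    rw [sub_zero, m4Num_div_eq hs1 hw hw1 hsw]
    simp only [hG, Nat.cast_zero, add_zero, Nat.cast_one, Nat.cast_two, hc₁, hc₂]
    push_cast
    ring
  have hI : ∀ k, k ≤ 2 → Integrable (G k) := fun k hk ↦ integrable_GammaK_zeta_sq_line hk hs hX
  have hval : ∀ k, k ≤ 2 → ∫ y, G k y = 2 * π * LSeries (smoothedPow k dCoeff X) s := by
    intro k hk
    have := integral_GammaK_cpow_LSeries_two hk norm_dCoeff_le_one_mul hX hs0 (k := k)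
    rw [← this]
    refine integral_congr_ae (Eventually.of_forall fun y ↦ ?_)
    simp only [hG]
    rw [LSeries_dCoeff (by norm_num [hs])]
  constructor
  · exact (((hI 0 (by norm_num)).add ((hI 1 (by norm_num)).const_mul c₁)).add
      ((hI 2 le_rfl).const_mul c₂)).congr (Eventually.of_forall fun y ↦ (hpt y).symm)
  · rw [integral_congr_ae (Eventually.of_forall hpt)]
    have e1 : ∫ y : ℝ, (G 0 y + c₁ * G 1 y + c₂ * G 2 y) =
        (∫ y : ℝ, (G 0 y + c₁ * G 1 y)) + ∫ y : ℝ, c₂ * G 2 y :=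
      integral_add (f := fun y ↦ G 0 y + c₁ * G 1 y) (g := fun y ↦ c₂ * G 2 y)
        ((hI 0 (by norm_num)).add ((hI 1 (by norm_num)).const_mul c₁)) ((hI 2 le_rfl).const_mul c₂)
    have e2 : ∫ y : ℝ, (G 0 y + c₁ * G 1 y) = (∫ y : ℝ, G 0 y) + ∫ y : ℝ, c₁ * G 1 y :=
      integral_add (f := fun y ↦ G 0 y) (g := fun y ↦ c₁ * G 1 y)
        (hI 0 (by norm_num)) ((hI 1 (by norm_num)).const_mul c₁)
    rw [e1, e2, integral_const_mul, integral_const_mul, hval 0 (by norm_num), hval 1 (by norm_num),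
      hval 2 le_rfl, Esum]
    ring

/-! ### The line `re w = −3/4` and the horizontal decay -/

/-- Pointwise bound for `F_s` on the closed strip `−3/4 ≤ re w ≤ 2` when `|im(s + w)| ≥ 1` or
`re w = −3/4` (so that `s + w` is at distance `≥ 1/2` from the pole), `re s = 1/2`:
`‖F_s(w)‖ ≤ 384² (1+|t|)⁸ C_Γ (X^{-3/4} + X²) ‖s−1‖⁻² (1+|im w|)¹¹ e^{-π|im w|/2}`. [folklore] -/
theorem norm_m4Num_le (hs : s.re = 1 / 2) (hX : 0 < X) {w : ℂ} (h1 : -(3 / 4) ≤ w.re) (h2 : w.re ≤ 2)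
    (hfar : 1 / 2 ≤ ‖s + w - 1‖) :
    ‖m4Num s X w‖ ≤ 384 ^ 2 * (1 + |s.im|) ^ 8 * CΓ * (X ^ (-(3 / 4) : ℝ) + X ^ (2 : ℝ)) / ‖s - 1‖ ^ 2 *
      ((1 + |w.im|) ^ 11 * Real.exp (-(π * |w.im| / 2))) := by
  have hs1 : s - 1 ≠ 0 := by
    intro h; have := congrArg Complex.re h; norm_num [hs] at this
  unfold m4Num
  rw [norm_div, norm_pow (s - 1), norm_mul, norm_mul, norm_pow, norm_ofReal_cpow hX]
  have hz := norm_riemannZeta₁_le (z := s + w) (by norm_num [hs]; linarith) (by norm_num [hs]; linarith) hfar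
  have hzim : (s + w).im = s.im + w.im := by simp
  rw [hzim] at hz
  have hpe := one_add_abs_add_le s.im w.im
  have hz' : ‖riemannZeta₁ (s + w)‖ ≤ 384 * ((1 + |s.im|) ^ 4 * (1 + |w.im|) ^ 4) := by
    refine hz.trans ?_
    have h0 : 0 ≤ 1 + |s.im + w.im| := by positivity
    calc 384 * (1 + |s.im + w.im|) ^ 4 ≤ 384 * ((1 + |s.im|) * (1 + |w.im|)) ^ 4 := by gcongr
      _ = _ := by ring
  have hΓ : ‖Complex.Gamma (w + 1)‖ ≤ CΓ * (1 + |w.im|) ^ 3 * Real.exp (-(π * |w.im| / 2)) := by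
    have := norm_Gamma_strip_le (x := w.re + 1) (by linarith) (by linarith) w.im
    have e : ((w.re + 1 : ℝ) : ℂ) + w.im * I = w + 1 := by
      rw [show ((w.re + 1 : ℝ) : ℂ) = (w.re : ℂ) + 1 by push_cast; ring]
      conv_rhs => rw [← Complex.re_add_im w]
      ring
    rwa [e] at this
  have hXw : X ^ w.re ≤ X ^ (-(3 / 4) : ℝ) + X ^ (2 : ℝ) := by
    rcases le_or_gt 1 X with hX1 | hX1
    · have := Real.rpow_le_rpow_of_exponent_le hX1 h2
      linarith [Real.rpow_nonneg hX.le (-(3 / 4) : ℝ)]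
    · have := Real.rpow_le_rpow_of_exponent_ge hX hX1.le h1
      linarith [Real.rpow_nonneg hX.le (2 : ℝ)]
  have hCΓ := CΓ_pos
  have h0 : 0 ≤ 1 + |w.im| := by positivity
  rw [div_eq_mul_inv _ (‖s - 1‖ ^ 2), div_eq_mul_inv _ (‖s - 1‖ ^ 2)]
  have hinv : 0 ≤ (‖s - 1‖ ^ 2)⁻¹ := by positivity
  calc ‖riemannZeta₁ (s + w)‖ ^ 2 * ‖Complex.Gamma (w + 1)‖ * X ^ w.re * (‖s - 1‖ ^ 2)⁻¹
      ≤ (384 * ((1 + |s.im|) ^ 4 * (1 + |w.im|) ^ 4)) ^ 2 *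
          (CΓ * (1 + |w.im|) ^ 3 * Real.exp (-(π * |w.im| / 2))) *
          (X ^ (-(3 / 4) : ℝ) + X ^ (2 : ℝ)) * (‖s - 1‖ ^ 2)⁻¹ := by gcongr
    _ = _ := by ring

/-- Integrability of `F_s(w)/w` on the line `re w = −3/4` (`re s = 1/2`, `X > 0`). [folklore] -/
theorem integrable_m4Num_line (hs : s.re = 1 / 2) (hX : 0 < X) :
    Integrable fun y : ℝ ↦ m4Num s X (((-(3 / 4) : ℝ) : ℂ) + y * I) / (((-(3 / 4) : ℝ) : ℂ) + y * I - 0) := by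
  set K : ℝ := 384 ^ 2 * (1 + |s.im|) ^ 8 * CΓ * (X ^ (-(3 / 4) : ℝ) + X ^ (2 : ℝ)) / ‖s - 1‖ ^ 2
    with hK
  have hc := continuous_m4Num_line s hX (c := -(3 / 4)) (by norm_num) (by norm_num)
  refine (((integrable_pow_mul_exp 11).const_mul (K * (4 / 3))).mono' ?_
    (Eventually.of_forall fun y ↦ ?_))
  · exact (hc.congr fun y ↦ by rw [sub_zero]).aestronglyMeasurable
  rw [sub_zero, norm_div]
  have hw : (3 / 4 : ℝ) ≤ ‖(((-(3 / 4) : ℝ) : ℂ) + y * I)‖ := by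
    have hre : ((((-(3 / 4) : ℝ) : ℂ) + y * I)).re = -(3 / 4) := by simp
    have := abs_re_le_norm ((((-(3 / 4) : ℝ) : ℂ) + y * I))
    rw [hre, abs_neg, abs_of_pos (by norm_num : (0 : ℝ) < 3 / 4)] at this
    exact this
  have hfar : 1 / 2 ≤ ‖s + ((((-(3 / 4) : ℝ) : ℂ) + y * I)) - 1‖ :=
    half_le_norm_sub_one_of_re (by norm_num [hs])
  have hb := norm_m4Num_le hs hX (w := (((-(3 / 4) : ℝ) : ℂ) + y * I)) (by simp) (by simp; norm_num) hfar
  rw [← hK] at hb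
  have him : ((((-(3 / 4) : ℝ) : ℂ) + y * I)).im = y := by simp
  rw [him] at hb
  have hK0 : 0 ≤ K := by rw [hK]; have := CΓ_pos; positivity
  rw [div_le_iff₀ (by linarith)]
  calc ‖m4Num s X ((((-(3 / 4) : ℝ) : ℂ) + y * I))‖
      ≤ K * ((1 + |y|) ^ 11 * Real.exp (-(π * |y| / 2))) := hb
    _ = K * (4 / 3) * ((1 + |y|) ^ 11 * Real.exp (-(π * |y| / 2))) * (3 / 4) := by ring
    _ ≤ K * (4 / 3) * ((1 + |y|) ^ 11 * Real.exp (-(π * |y| / 2))) * ‖(((-(3 / 4) : ℝ) : ℂ) + y * I)‖ := by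
        gcongr

/-- Horizontal decay of `F_s(w)/w` in the strip `−3/4 ≤ re w ≤ 2`. [folklore] -/
theorem m4Num_horizontal_decay (hs : s.re = 1 / 2) (hX : 0 < X) (ε : ℝ) (hε : 0 < ε) :
    ∃ T₀ : ℝ, ∀ σ ∈ Icc (-(3 / 4) : ℝ) 2, ∀ T : ℝ, T₀ ≤ |T| →
      ‖m4Num s X (σ + T * I) / (σ + T * I - 0)‖ ≤ ε := by
  set K : ℝ := 384 ^ 2 * (1 + |s.im|) ^ 8 * CΓ * (X ^ (-(3 / 4) : ℝ) + X ^ (2 : ℝ)) / ‖s - 1‖ ^ 2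
    with hK
  have hK0 : 0 ≤ K := by rw [hK]; have := CΓ_pos; positivity
  obtain ⟨T₁, hT₁⟩ := exists_pow_mul_exp_le 11 hK0 hε
  refine ⟨max T₁ (|s.im| + 1), fun σ hσ T hT ↦ ?_⟩
  have hTT : T₁ ≤ |T| := le_trans (le_max_left _ _) hT
  have hT1 : |s.im| + 1 ≤ |T| := le_trans (le_max_right _ _) hT
  have hT1' : 1 ≤ |T| := le_trans (by linarith [abs_nonneg s.im]) hT1
  set w : ℂ := (σ : ℂ) + T * I with hw
  have hwim : w.im = T := by simp [hw]
  have hwre : w.re = σ := by simp [hw]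
  have hfar : 1 / 2 ≤ ‖s + w - 1‖ := by
    refine half_le_norm_sub_one_of_im ?_
    simp only [add_im, hwim]
    have := abs_sub_abs_le_abs_sub T (-s.im)
    rw [abs_neg, sub_neg_eq_add, add_comm] at this
    linarith
  have hb := norm_m4Num_le hs hX (w := w) (by rw [hwre]; exact hσ.1) (by rw [hwre]; exact hσ.2) hfar
  rw [← hK, hwim] at hb
  rw [sub_zero, norm_div]
  have hwn : 1 ≤ ‖w‖ := by
    have := abs_im_le_norm w; rw [hwim] at this; linarith
  calc ‖m4Num s X w‖ / ‖w‖ ≤ ‖m4Num s X w‖ := div_le_self (norm_nonneg _) hwn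
    _ ≤ K * ((1 + |T|) ^ 11 * Real.exp (-(π * |T| / 2))) := hb
    _ ≤ ε := hT₁ T hTT

/-- **The first identity** (Mellin on `re w = 2` and the shift to `re w = −3/4` across the
simple pole of `F_s(w)/w` at `w = 0`): for `re s = 1/2` and `X > 0`,
`2π ζ(s)² = 2π E(s) − ∫ F_s(−3/4 + iy)/(−3/4 + iy) dy`. [folklore] -/
theorem m4_identity₁ (hs : s.re = 1 / 2) (hX : 0 < X) :
    2 * π * riemannZeta s ^ 2 = 2 * π * Esum s X -
      ∫ y : ℝ, m4Num s X (((-(3 / 4) : ℝ) : ℂ) + y * I) / (((-(3 / 4) : ℝ) : ℂ) + y * I - 0) := by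
  have hs1 : s ≠ 1 := by intro h; rw [h] at hs; norm_num at hs
  obtain ⟨hIb, hvb⟩ := integral_m4Num_two hs hX
  have hshift := integral_vertical_sub_eq_of_pole (m4Num s X) 0 (a := -(3 / 4)) (b := 2)
    (by simp) (by simp) ((differentiableOn_m4Num s hX).mono fun w hw ↦ by
      simp only [Set.mem_setOf_eq]; have := hw.1.1; linarith)
    (integrable_m4Num_line hs hX) hIb (m4Num_horizontal_decay hs hX)
  rw [hvb, m4Num_zero hs1] at hshift
  linear_combination -hshift

end ZetaM4

end Literature.NumberTheory.LFunctions

end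

noncomputable section

open Real Set Filter Topology Complex MeasureTheory Finset
open scoped ComplexConjugate

namespace Literature.NumberTheory.LFunctions

namespace ZetaM4

open HuxleyZeroDetection
open MellinBarnes (norm_ofReal_cpow)

/-! ## §5. The functional equation on `re w = −3/4`, the split `n ≤ N` / `n > N`, and the shift back to `re w = 1/4`

On `re w = −3/4` (`z = s + w`, `re z = −1/4`): `ζ₁(z)² = (z−1)² F(1−z)² ζ(1−z)²` and
`ζ(1−z)² = L(d, 1−z) = A_N(1−z) + B_N(1−z)` (`re(1−z) = 5/4`), `A_N(u) = ∑_{n ≤ N} d(n) n^{-u}`.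
The finite part `G(w) = K(w) A_N(1−s−w)`, `K(w) = (s+w−1)² F(1−s−w)² Γ(w+1) X^w/(s−1)²`, is
holomorphic on `−1 < re w < 1/2`, and `G(w)/w` is moved back to `re w = 1/4` across its simple pole
at `w = 0` (residue `F(1−s)² A_N(1−s)`). -/

variable {s : ℂ} {X : ℝ} {N : ℕ}

/-- The Dirichlet polynomial `A_N(u) = ∑_{n ≤ N} d(n) n^{-u}`. [folklore] -/
def dirPoly (N : ℕ) (u : ℂ) : ℂ := ∑ n ∈ Finset.Icc 1 N, dCoeff n * (n : ℂ) ^ (-u)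

/-- The tail coefficients `d(n) [n > N]`. [folklore] -/
def tailCoeff (N : ℕ) (n : ℕ) : ℂ := if N < n then dCoeff n else 0

/-- `L(d, u)` is summable for `re u > 1`. [folklore] -/
theorem LSeriesSummable_dCoeff {u : ℂ} (hu : 1 < u.re) : LSeriesSummable dCoeff u :=
  (LSeriesSummable_one_iff.2 hu).convolution (LSeriesSummable_one_iff.2 hu)

/-- The tail series is summable for `re u > 1`. [folklore] -/
theorem LSeriesSummable_tailCoeff {u : ℂ} (hu : 1 < u.re) (N : ℕ) :
    LSeriesSummable (tailCoeff N) u := by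
  refine (LSeriesSummable_dCoeff hu).congr' u ?_
  filter_upwards [eventually_gt_atTop N] with n hn
  rw [tailCoeff, if_pos hn]

/-- **`L(d, u) = A_N(u) + ∑_{n > N} d(n) n^{-u}`** for `re u > 1`. [folklore] -/
theorem LSeries_dCoeff_eq_dirPoly_add {u : ℂ} (hu : 1 < u.re) (N : ℕ) :
    LSeries dCoeff u = dirPoly N u + LSeries (tailCoeff N) u := by
  set hd : ℕ → ℂ := fun n ↦ if n ≤ N then dCoeff n else 0 with hhd
  have hsplit : dCoeff = hd + tailCoeff N := by
    funext n
    simp only [Pi.add_apply, hhd, tailCoeff]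
    by_cases h : n ≤ N
    · rw [if_pos h, if_neg (not_lt.2 h), add_zero]
    · rw [if_neg h, if_pos (not_le.1 h), zero_add]
  have hhdS : LSeriesSummable hd u := by
    refine summable_of_ne_finset_zero (s := Finset.Icc 1 N) fun n hn ↦ ?_
    rw [Finset.mem_Icc, not_and_or, not_le, not_le] at hn
    rcases hn with hn | hn
    · have : n = 0 := by omega
      subst this; exact LSeries.term_zero _ _
    · rw [LSeries.term_of_ne_zero (by omega), hhd]
      simp only
      rw [if_neg (by omega), zero_div]
  have hhdL : LSeries hd u = dirPoly N u := by
    rw [LSeries, dirPoly, tsum_eq_sum (s := Finset.Icc 1 N)]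
    · refine Finset.sum_congr rfl fun n hn ↦ ?_
      rw [Finset.mem_Icc] at hn
      rw [LSeries.term_of_ne_zero (by omega), hhd]
      simp only
      rw [if_pos hn.2, cpow_neg, div_eq_mul_inv]
    · intro n hn
      rw [Finset.mem_Icc, not_and_or, not_le, not_le] at hn
      rcases hn with hn | hn
      · have : n = 0 := by omega
        subst this; exact LSeries.term_zero _ _
      · rw [LSeries.term_of_ne_zero (by omega), hhd]
        simp only
        rw [if_neg (by omega), zero_div]
  conv_lhs => rw [hsplit]
  rw [LSeries_add hhdS (LSeriesSummable_tailCoeff hu N), hhdL]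

/-- `A_N` is entire. [folklore] -/
theorem differentiable_dirPoly (N : ℕ) : Differentiable ℂ (dirPoly N) := by
  unfold dirPoly
  refine Differentiable.fun_sum fun n hn ↦ ?_
  rw [Finset.mem_Icc] at hn
  refine (differentiable_const _).mul ?_
  exact differentiable_id.neg.const_cpow (Or.inl (Nat.cast_ne_zero.2 (by omega)))

/-- `‖A_N(u)‖ ≤ ∑_{n ≤ N} d(n) n^{-re u}`. [folklore] -/
theorem norm_dirPoly_le (N : ℕ) (u : ℂ) :
    ‖dirPoly N u‖ ≤ ∑ n ∈ Finset.Icc 1 N, (n.divisors.card : ℝ) * (n : ℝ) ^ (-u.re) := by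
  unfold dirPoly
  refine (norm_sum_le _ _).trans (Finset.sum_le_sum fun n hn ↦ ?_)
  rw [Finset.mem_Icc] at hn
  rw [norm_mul, norm_dCoeff, Complex.norm_natCast_cpow_of_pos (by omega), neg_re]

/-- Crude bound: `‖A_N(u)‖ ≤ N²` for `re u ≥ 0`. [folklore] -/
theorem norm_dirPoly_le_sq (N : ℕ) {u : ℂ} (hu : 0 ≤ u.re) : ‖dirPoly N u‖ ≤ (N : ℝ) ^ 2 := by
  refine (norm_dirPoly_le N u).trans ?_
  calc ∑ n ∈ Finset.Icc 1 N, (n.divisors.card : ℝ) * (n : ℝ) ^ (-u.re)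
      ≤ ∑ n ∈ Finset.Icc 1 N, (N : ℝ) := Finset.sum_le_sum fun n hn ↦ by
        rw [Finset.mem_Icc] at hn
        have h1 : (n.divisors.card : ℝ) ≤ n := by exact_mod_cast Nat.card_divisors_le_self n
        have h2 : (n : ℝ) ^ (-u.re) ≤ 1 :=
          Real.rpow_le_one_of_one_le_of_nonpos (by exact_mod_cast hn.1) (by linarith)
        have h3 : (n : ℝ) ≤ N := by exact_mod_cast hn.2
        calc (n.divisors.card : ℝ) * (n : ℝ) ^ (-u.re) ≤ n * 1 :=
              mul_le_mul h1 h2 (by positivity) (Nat.cast_nonneg n)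
          _ ≤ N := by linarith
    _ = (N : ℝ) ^ 2 := by simp [sq]

/-- The reflected kernel `K(w) = (s+w−1)² F(1−s−w)² Γ(w+1) X^w / (s−1)²`. [folklore] -/
def rK (s : ℂ) (X : ℝ) (w : ℂ) : ℂ :=
  (s + w - 1) ^ 2 * feFactor (1 - s - w) ^ 2 * Complex.Gamma (w + 1) * (X : ℂ) ^ w / (s - 1) ^ 2

/-- The finite reflected part `G(w) = K(w) A_N(1 − s − w)`. [folklore] -/
def Gfun (s : ℂ) (X : ℝ) (N : ℕ) (w : ℂ) : ℂ := rK s X w * dirPoly N (1 - s - w)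

/-- **The functional equation on `re w = −3/4`**: for `re s = 1/2`,
`F_s(w)/w = (K(w)/w) · L(d, 1 − s − w)`. [folklore] -/
theorem m4Num_div_eq_rK (hs : s.re = 1 / 2) (y : ℝ) :
    m4Num s X (((-(3 / 4) : ℝ) : ℂ) + y * I) / ((((-(3 / 4) : ℝ) : ℂ) + y * I)) =
      rK s X (((-(3 / 4) : ℝ) : ℂ) + y * I) / ((((-(3 / 4) : ℝ) : ℂ) + y * I)) *
        LSeries dCoeff (1 - s - (((-(3 / 4) : ℝ) : ℂ) + y * I)) := by
  set w : ℂ := (((-(3 / 4) : ℝ) : ℂ) + y * I) with hw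
  set z : ℂ := s + w with hz
  have hzre : z.re = -(1 / 4) := by simp [hz, hw, hs]; norm_num
  have hz1 : z ≠ 1 := by intro h; rw [h] at hzre; norm_num at hzre
  have hz0 : z ≠ 0 := by intro h; rw [h] at hzre; norm_num at hzre
  have hzn : ∀ n : ℕ, z ≠ 1 + n := by
    intro n h; rw [h] at hzre; simp only [add_re, one_re, natCast_re] at hzre
    linarith [(Nat.cast_nonneg n : (0 : ℝ) ≤ n)]
  have hfe := riemannZeta_eq_feFactor_mul hzn hz0
  have hL : riemannZeta (1 - z) ^ 2 = LSeries dCoeff (1 - z) :=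
    (LSeries_dCoeff (by simp only [sub_re, one_re, hzre]; norm_num)).symm
  have e1 : 1 - s - w = 1 - z := by rw [hz]; ring
  unfold m4Num rK
  rw [← hz, LFunctions.riemannZeta₁_eq_mul hz1, hfe, e1, ← hL, show s + w - 1 = z - 1 by rw [hz]]
  ring

/-- `G` is holomorphic on `−1 < re w < 1/2` (`re s = 1/2`, `X > 0`). [folklore] -/
theorem differentiableOn_Gfun (hs : s.re = 1 / 2) (hX : 0 < X) (N : ℕ) :
    DifferentiableOn ℂ (Gfun s X N) {w : ℂ | -1 < w.re ∧ w.re < 1 / 2} := by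
  intro w hw
  simp only [Set.mem_setOf_eq] at hw
  refine DifferentiableAt.differentiableWithinAt ?_
  unfold Gfun rK
  have hlin : DifferentiableAt ℂ (fun w : ℂ ↦ 1 - s - w) w := (differentiableAt_const _).sub differentiableAt_id
  have hsw : DifferentiableAt ℂ (fun w : ℂ ↦ s + w - 1) w :=
    ((differentiableAt_const s).add differentiableAt_id).sub (differentiableAt_const 1)
  refine (((((hsw.pow 2).mul ?_).mul ?_).mul ?_).div_const _).mul ?_
  · refine (DifferentiableAt.comp w (differentiableAt_feFactor fun m hm ↦ ?_) hlin).pow 2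
    have := congrArg Complex.re hm
    simp [hs] at this
    linarith [(Nat.cast_nonneg m : (0 : ℝ) ≤ m)]
  · refine (Complex.differentiableAt_Gamma _ fun m hm ↦ ?_).comp w (differentiableAt_id.add_const 1)
    have := congrArg Complex.re hm
    simp at this
    linarith [(Nat.cast_nonneg m : (0 : ℝ) ≤ m)]
  · exact differentiableAt_id.const_cpow (Or.inl (ofReal_ne_zero.2 hX.ne'))
  · exact (differentiable_dirPoly N).differentiableAt.comp w hlin

/-- `G(0) = F(1−s)² A_N(1−s)`. [folklore] -/
theorem Gfun_zero (hs1 : s ≠ 1) (X : ℝ) (N : ℕ) :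
    Gfun s X N 0 = feFactor (1 - s) ^ 2 * dirPoly N (1 - s) := by
  unfold Gfun rK
  have : s - 1 ≠ 0 := sub_ne_zero.2 hs1
  rw [add_zero, sub_zero, zero_add, Complex.Gamma_one, cpow_zero]
  field_simp

/-- Pointwise bound for the kernel on the strip `−3/4 ≤ re w ≤ 1/4` (`re s = 1/2`): with
`t = im s`, `‖K(w)‖ ≤ 4(1+|t|)² · (6Γ(1/4)e^{π/2})² (1+|t|)⁴ · C_Γ · (X^{-3/4} + X^{1/4}) · 4 ·
(1+|im w|)⁹ e^{-π|im w|/2}`. [folklore] -/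
theorem norm_rK_le (hs : s.re = 1 / 2) (hX : 0 < X) {w : ℂ} (h1 : -(3 / 4) ≤ w.re) (h2 : w.re ≤ 1 / 4) :
    ‖rK s X w‖ ≤ 4 * (1 + |s.im|) ^ 6 * (6 * Real.Gamma (1 / 4) * Real.exp (π / 2)) ^ 2 * CΓ *
      (X ^ (-(3 / 4) : ℝ) + X ^ (1 / 4 : ℝ)) * 4 *
      ((1 + |w.im|) ^ 9 * Real.exp (-(π * |w.im| / 2))) := by
  have hs1n : ‖s - 1‖ ^ 2 ≥ 1 / 4 := by
    have := abs_re_le_norm (s - 1)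
    simp only [sub_re, one_re, hs] at this
    rw [show |(1 / 2 : ℝ) - 1| = 1 / 2 by norm_num] at this
    nlinarith [norm_nonneg (s - 1)]
  have hw0 : 0 ≤ 1 + |w.im| := by positivity
  have ht0 : 0 ≤ 1 + |s.im| := by positivity
  -- the four factors
  have hA : ‖s + w - 1‖ ≤ 2 * ((1 + |s.im|) * (1 + |w.im|)) := by
    have := Complex.norm_le_abs_re_add_abs_im (s + w - 1)
    simp only [sub_re, add_re, one_re, sub_im, add_im, one_im, sub_zero, hs] at this
    have hre : |1 / 2 + w.re - 1| ≤ 2 := abs_le.2 ⟨by linarith, by linarith⟩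
    have him := abs_add_le s.im w.im
    nlinarith [abs_nonneg s.im, abs_nonneg w.im]
  have hF : ‖feFactor (1 - s - w)‖ ≤ 6 * Real.Gamma (1 / 4) * Real.exp (π / 2) *
      ((1 + |s.im|) * (1 + |w.im|)) ^ 2 := by
    have e : (1 - s - w) = (((1 - s - w).re : ℝ) : ℂ) + ((1 - s - w).im : ℝ) * I :=
      (Complex.re_add_im _).symm
    rw [e]
    refine (norm_feFactor_strip_le (x := (1 - s - w).re) (by simp [hs]; linarith)
      (by simp [hs]; linarith) _).trans ?_
    have him : |(1 - s - w).im| = |s.im + w.im| := by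
      simp only [sub_im, one_im, zero_sub]
      rw [show -s.im - w.im = -(s.im + w.im) by ring, abs_neg]
    rw [him]
    have := one_add_abs_add_le s.im w.im
    have h0 : 0 ≤ 1 + |s.im + w.im| := by positivity
    have hK : 0 ≤ 6 * Real.Gamma (1 / 4) * Real.exp (π / 2) := by
      have := Real.Gamma_pos_of_pos (by norm_num : (0 : ℝ) < 1 / 4); positivity
    exact mul_le_mul_of_nonneg_left (pow_le_pow_left₀ h0 this 2) hK
  have hΓ : ‖Complex.Gamma (w + 1)‖ ≤ CΓ * (1 + |w.im|) ^ 3 * Real.exp (-(π * |w.im| / 2)) := by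
    have := norm_Gamma_strip_le (x := w.re + 1) (by linarith) (by linarith) w.im
    have e : ((w.re + 1 : ℝ) : ℂ) + w.im * I = w + 1 := by
      rw [show ((w.re + 1 : ℝ) : ℂ) = (w.re : ℂ) + 1 by push_cast; ring]
      conv_rhs => rw [← Complex.re_add_im w]
      ring
    rwa [e] at this
  have hXw : ‖(X : ℂ) ^ w‖ ≤ X ^ (-(3 / 4) : ℝ) + X ^ (1 / 4 : ℝ) := by
    rw [norm_ofReal_cpow hX]
    rcases le_or_gt 1 X with hX1 | hX1
    · have := Real.rpow_le_rpow_of_exponent_le hX1 h2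
      linarith [Real.rpow_nonneg hX.le (-(3 / 4) : ℝ)]
    · have := Real.rpow_le_rpow_of_exponent_ge hX hX1.le h1
      linarith [Real.rpow_nonneg hX.le (1 / 4 : ℝ)]
  have hinv : ‖((s - 1) ^ 2)⁻¹‖ ≤ 4 := by
    rw [norm_inv, norm_pow]
    rw [inv_le_comm₀ (by positivity) (by norm_num)]
    linarith
  have hCΓ := CΓ_pos
  have hΓ14 := Real.Gamma_pos_of_pos (by norm_num : (0 : ℝ) < 1 / 4)
  unfold rK
  rw [div_eq_mul_inv, norm_mul, norm_mul, norm_mul, norm_mul, norm_pow, norm_pow]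
  calc ‖s + w - 1‖ ^ 2 * ‖feFactor (1 - s - w)‖ ^ 2 * ‖Complex.Gamma (w + 1)‖ * ‖(X : ℂ) ^ w‖ *
        ‖((s - 1) ^ 2)⁻¹‖
      ≤ (2 * ((1 + |s.im|) * (1 + |w.im|))) ^ 2 *
          (6 * Real.Gamma (1 / 4) * Real.exp (π / 2) * ((1 + |s.im|) * (1 + |w.im|)) ^ 2) ^ 2 *
          (CΓ * (1 + |w.im|) ^ 3 * Real.exp (-(π * |w.im| / 2))) *
          (X ^ (-(3 / 4) : ℝ) + X ^ (1 / 4 : ℝ)) * 4 := by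
        gcongr
    _ = 4 * (1 + |s.im|) ^ 6 * (6 * Real.Gamma (1 / 4) * Real.exp (π / 2)) ^ 2 * CΓ *
          (X ^ (-(3 / 4) : ℝ) + X ^ (1 / 4 : ℝ)) * 4 *
          ((1 + |w.im|) ^ 9 * Real.exp (-(π * |w.im| / 2))) := by ring

/-- Integrability of `G(w)/w` on the lines `re w = −3/4` and `re w = 1/4`. [folklore] -/
theorem integrable_Gfun_line (hs : s.re = 1 / 2) (hX : 0 < X) (N : ℕ) {c : ℝ} (hc : c = -(3 / 4) ∨ c = 1 / 4) :
    Integrable fun y : ℝ ↦ Gfun s X N ((c : ℂ) + y * I) / ((c : ℂ) + y * I - 0) := by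
  have hc1 : -(3 / 4) ≤ c ∧ c ≤ 1 / 4 := by rcases hc with rfl | rfl <;> norm_num
  have hc0 : c ≠ 0 := by rcases hc with rfl | rfl <;> norm_num
  have hca : 1 / 4 ≤ |c| := by
    rcases hc with rfl | rfl
    · rw [abs_of_neg (by norm_num)]; norm_num
    · rw [abs_of_pos (by norm_num)]
  -- continuity
  have hcont : Continuous fun y : ℝ ↦ Gfun s X N ((c : ℂ) + y * I) / ((c : ℂ) + y * I - 0) := by
    have hd := differentiableOn_Gfun hs hX N
    have hline : Continuous fun y : ℝ ↦ (c : ℂ) + y * I := by fun_prop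
    refine (hd.continuousOn.comp_continuous hline fun y ↦ ?_).div (hline.sub continuous_const)
      fun y h ↦ hc0 ?_
    · simp only [Set.mem_setOf_eq, add_re, ofReal_re, mul_re, I_re, mul_zero, ofReal_im, I_im,
        mul_one, sub_self, add_zero]
      exact ⟨by linarith [hc1.1], by linarith [hc1.2]⟩
    · have := congrArg Complex.re h; simpa using this
  set K : ℝ := 4 * (1 + |s.im|) ^ 6 * (6 * Real.Gamma (1 / 4) * Real.exp (π / 2)) ^ 2 * CΓ *
      (X ^ (-(3 / 4) : ℝ) + X ^ (1 / 4 : ℝ)) * 4 with hK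
  have hCΓ := CΓ_pos
  have hΓ14 := Real.Gamma_pos_of_pos (by norm_num : (0 : ℝ) < 1 / 4)
  have hK0 : 0 ≤ K := by positivity
  refine (((integrable_pow_mul_exp 9).const_mul (K * (N : ℝ) ^ 2 * 4)).mono' hcont.aestronglyMeasurable
    (Eventually.of_forall fun y ↦ ?_))
  rw [sub_zero, norm_div, Gfun, norm_mul]
  have hw : (1 / 4 : ℝ) ≤ ‖((c : ℂ) + y * I)‖ := by
    have := abs_re_le_norm ((c : ℂ) + y * I)
    simp only [add_re, ofReal_re, mul_re, I_re, mul_zero, ofReal_im, I_im, mul_one, sub_self,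
      add_zero] at this
    linarith
  have hKb := norm_rK_le hs hX (w := (c : ℂ) + y * I) (by simp only [add_re, ofReal_re, mul_re,
    I_re, mul_zero, ofReal_im, I_im, mul_one, sub_self, add_zero]; exact hc1.1)
    (by simp only [add_re, ofReal_re, mul_re, I_re, mul_zero, ofReal_im, I_im, mul_one, sub_self,
      add_zero]; exact hc1.2)
  rw [← hK] at hKb
  have him : ((c : ℂ) + y * I).im = y := by simp
  rw [him] at hKb
  have hA : ‖dirPoly N (1 - s - ((c : ℂ) + y * I))‖ ≤ (N : ℝ) ^ 2 :=
    norm_dirPoly_le_sq N (by simp [hs]; linarith [hc1.2])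
  rw [div_le_iff₀ (by linarith)]
  have hP : 0 ≤ (1 + |y|) ^ 9 * Real.exp (-(π * |y| / 2)) := by positivity
  calc ‖rK s X ((c : ℂ) + y * I)‖ * ‖dirPoly N (1 - s - ((c : ℂ) + y * I))‖
      ≤ K * ((1 + |y|) ^ 9 * Real.exp (-(π * |y| / 2))) * (N : ℝ) ^ 2 :=
        mul_le_mul hKb hA (norm_nonneg _) (by positivity)
    _ = K * (N : ℝ) ^ 2 * 4 * ((1 + |y|) ^ 9 * Real.exp (-(π * |y| / 2))) * (1 / 4) := by ring
    _ ≤ K * (N : ℝ) ^ 2 * 4 * ((1 + |y|) ^ 9 * Real.exp (-(π * |y| / 2))) * ‖((c : ℂ) + y * I)‖ := by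
        gcongr

/-- Horizontal decay of `G(w)/w` in the strip `−3/4 ≤ re w ≤ 1/4`. [folklore] -/
theorem Gfun_horizontal_decay (hs : s.re = 1 / 2) (hX : 0 < X) (N : ℕ) (ε : ℝ) (hε : 0 < ε) :
    ∃ T₀ : ℝ, ∀ σ ∈ Icc (-(3 / 4) : ℝ) (1 / 4), ∀ T : ℝ, T₀ ≤ |T| →
      ‖Gfun s X N (σ + T * I) / (σ + T * I - 0)‖ ≤ ε := by
  set K : ℝ := 4 * (1 + |s.im|) ^ 6 * (6 * Real.Gamma (1 / 4) * Real.exp (π / 2)) ^ 2 * CΓ *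
      (X ^ (-(3 / 4) : ℝ) + X ^ (1 / 4 : ℝ)) * 4 with hK
  have hCΓ := CΓ_pos
  have hΓ14 := Real.Gamma_pos_of_pos (by norm_num : (0 : ℝ) < 1 / 4)
  have hK0 : 0 ≤ K * (N : ℝ) ^ 2 := by positivity
  obtain ⟨T₁, hT₁⟩ := exists_pow_mul_exp_le 9 hK0 hε
  refine ⟨max T₁ 1, fun σ hσ T hT ↦ ?_⟩
  have hTT : T₁ ≤ |T| := le_trans (le_max_left _ _) hT
  have hT1 : 1 ≤ |T| := le_trans (le_max_right _ _) hT
  set w : ℂ := (σ : ℂ) + T * I with hw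
  have hwim : w.im = T := by simp [hw]
  have hwre : w.re = σ := by simp [hw]
  have hKb := norm_rK_le hs hX (w := w) (by rw [hwre]; exact hσ.1) (by rw [hwre]; exact hσ.2)
  rw [← hK, hwim] at hKb
  have hA : ‖dirPoly N (1 - s - w)‖ ≤ (N : ℝ) ^ 2 :=
    norm_dirPoly_le_sq N (by simp [hs, hwre]; linarith [hσ.2])
  rw [sub_zero, norm_div, Gfun, norm_mul]
  have hwn : 1 ≤ ‖w‖ := by
    have := abs_im_le_norm w; rw [hwim] at this; linarith
  have hP : 0 ≤ (1 + |T|) ^ 9 * Real.exp (-(π * |T| / 2)) := by positivity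
  calc ‖rK s X w‖ * ‖dirPoly N (1 - s - w)‖ / ‖w‖ ≤ ‖rK s X w‖ * ‖dirPoly N (1 - s - w)‖ :=
        div_le_self (by positivity) hwn
    _ ≤ K * ((1 + |T|) ^ 9 * Real.exp (-(π * |T| / 2))) * (N : ℝ) ^ 2 :=
        mul_le_mul hKb hA (norm_nonneg _) (by rw [hK]; positivity)
    _ = K * (N : ℝ) ^ 2 * ((1 + |T|) ^ 9 * Real.exp (-(π * |T| / 2))) := by ring
    _ ≤ ε := hT₁ T hTT

/-- **The second shift** (`re w = −3/4 → 1/4` across the simple pole of `G(w)/w` at `0`):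
`∫ G(1/4+iy)/(1/4+iy) dy − ∫ G(−3/4+iy)/(−3/4+iy) dy = 2π F(1−s)² A_N(1−s)`. [folklore] -/
theorem Gfun_shift (hs : s.re = 1 / 2) (hX : 0 < X) (N : ℕ) :
    (∫ y : ℝ, Gfun s X N ((((1 / 4 : ℝ)) : ℂ) + y * I) / ((((1 / 4 : ℝ)) : ℂ) + y * I - 0)) -
      (∫ y : ℝ, Gfun s X N (((-(3 / 4) : ℝ) : ℂ) + y * I) / ((((-(3 / 4) : ℝ)) : ℂ) + y * I - 0)) =
      2 * π * (feFactor (1 - s) ^ 2 * dirPoly N (1 - s)) := by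
  have hs1 : s ≠ 1 := by intro h; rw [h] at hs; norm_num at hs
  have hshift := integral_vertical_sub_eq_of_pole (Gfun s X N) 0 (a := -(3 / 4)) (b := 1 / 4)
    (by simp) (by norm_num) ((differentiableOn_Gfun hs hX N).mono fun w hw ↦ by
      simp only [Set.mem_setOf_eq]; exact ⟨by have := hw.1.1; linarith, by have := hw.1.2; linarith⟩)
    (integrable_Gfun_line hs hX N (Or.inl rfl)) (integrable_Gfun_line hs hX N (Or.inr rfl))
    (Gfun_horizontal_decay hs hX N)
  rw [Gfun_zero hs1] at hshift
  exact hshift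

/-- The `H`-integral: `∫ (F_s(w) − G(w))/w` on `re w = −3/4`, i.e. the contribution of the tail
`∑_{n > N} d(n) n^{s+w−1}`. [folklore] -/
def Hint (s : ℂ) (X : ℝ) (N : ℕ) : ℂ :=
  ∫ y : ℝ, (m4Num s X (((-(3 / 4) : ℝ) : ℂ) + y * I) / ((((-(3 / 4) : ℝ)) : ℂ) + y * I - 0) -
    Gfun s X N (((-(3 / 4) : ℝ) : ℂ) + y * I) / ((((-(3 / 4) : ℝ)) : ℂ) + y * I - 0))

/-- The `G`-integral on `re w = 1/4`. [folklore] -/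
def Gint (s : ℂ) (X : ℝ) (N : ℕ) : ℂ :=
  ∫ y : ℝ, Gfun s X N ((((1 / 4 : ℝ)) : ℂ) + y * I) / ((((1 / 4 : ℝ)) : ℂ) + y * I - 0)

/-- On `re w = −3/4` the `H`-integrand is the kernel times the tail series:
`(F_s(w) − G(w))/w = (K(w)/w) ∑_{n>N} d(n) n^{-(1−s−w)}`. [folklore] -/
theorem Hintegrand_eq (hs : s.re = 1 / 2) (N : ℕ) (y : ℝ) :
    m4Num s X (((-(3 / 4) : ℝ) : ℂ) + y * I) / ((((-(3 / 4) : ℝ)) : ℂ) + y * I - 0) -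
      Gfun s X N (((-(3 / 4) : ℝ) : ℂ) + y * I) / ((((-(3 / 4) : ℝ)) : ℂ) + y * I - 0) =
      rK s X (((-(3 / 4) : ℝ) : ℂ) + y * I) / ((((-(3 / 4) : ℝ)) : ℂ) + y * I) *
        LSeries (tailCoeff N) (1 - s - (((-(3 / 4) : ℝ) : ℂ) + y * I)) := by
  rw [sub_zero, m4Num_div_eq_rK hs y, Gfun,
    LSeries_dCoeff_eq_dirPoly_add (u := 1 - s - (((-(3 / 4) : ℝ) : ℂ) + y * I)) (by simp [hs]; norm_num) N]
  ring

/-- **The reflection decomposition of `ζ(s)²` on the critical line**: for `re s = 1/2`, `X > 0`,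
`N ∈ ℕ`: `ζ(s)² = E(s) + F(1−s)² A_N(1−s) − (2π)⁻¹ Gint − (2π)⁻¹ Hint`. [folklore] -/
theorem zeta_sq_decomposition (hs : s.re = 1 / 2) (hX : 0 < X) (N : ℕ) :
    riemannZeta s ^ 2 = Esum s X + feFactor (1 - s) ^ 2 * dirPoly N (1 - s) -
      (1 / (2 * π)) * Gint s X N - (1 / (2 * π)) * Hint s X N := by
  have h1 := m4_identity₁ hs hX
  have h2 := Gfun_shift hs hX N
  have hIm := integrable_m4Num_line hs hX
  have hIG := integrable_Gfun_line hs hX N (Or.inl rfl)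
  have hH : Hint s X N = (∫ y : ℝ, m4Num s X (((-(3 / 4) : ℝ) : ℂ) + y * I) /
      ((((-(3 / 4) : ℝ)) : ℂ) + y * I - 0)) -
      ∫ y : ℝ, Gfun s X N (((-(3 / 4) : ℝ) : ℂ) + y * I) / ((((-(3 / 4) : ℝ)) : ℂ) + y * I - 0) := by
    rw [Hint, integral_sub hIm hIG]
  rw [Gint, hH]
  have hπ : (2 * π : ℂ) ≠ 0 := by
    exact mul_ne_zero two_ne_zero (ofReal_ne_zero.2 Real.pi_pos.ne')
  set IG1 := ∫ y : ℝ, Gfun s X N ((((1 / 4 : ℝ)) : ℂ) + y * I) / ((((1 / 4 : ℝ)) : ℂ) + y * I - 0)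
  set IG0 := ∫ y : ℝ, Gfun s X N (((-(3 / 4) : ℝ) : ℂ) + y * I) / ((((-(3 / 4) : ℝ)) : ℂ) + y * I - 0)
  set IM := ∫ y : ℝ, m4Num s X (((-(3 / 4) : ℝ) : ℂ) + y * I) / ((((-(3 / 4) : ℝ)) : ℂ) + y * I - 0)
  -- `2π ζ² = 2π E − IM`, `IG1 − IG0 = 2π F² A`
  have key : 2 * π * riemannZeta s ^ 2 =
      2 * π * (Esum s X + feFactor (1 - s) ^ 2 * dirPoly N (1 - s)) - IG1 - (IM - IG0) := by
    linear_combination h1 + h2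
  have key2 : riemannZeta s ^ 2 =
      (2 * π * (Esum s X + feFactor (1 - s) ^ 2 * dirPoly N (1 - s)) - IG1 - (IM - IG0)) / (2 * π) := by
    rw [← key]; field_simp
  rw [key2]
  field_simp

end ZetaM4

end Literature.NumberTheory.LFunctions

end
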